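import Mathlib.Analysis.Calculus.ParametricIntegral
import Mathlib.Analysis.Calculus.ContDiff.FiniteDimension
import Mathlib.Analysis.Calculus.FDeriv.Symmetric
import Mathlib.MeasureTheory.Integral.Bochner.ContinuousLinearMap
import Mathlib.MeasureTheory.Integral.Prod
import Literature.Analysis.FluidPDE.NewtonPotential
import Literature.Analysis.FluidPDE.PressurePoisson
import Literature.Analysis.FluidPDE.WeakGradientIBP
import Literature.Analysis.FluidPDE.TaoEnstrophyLocalisationProofs
import Literature.Analysis.FluidPDE.NormalisedPressurePV
import HarnessLib

/-!
# The singular-integral representation of the normalised pressure on `ℝ³`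

Analysis/FluidPDE support file for the discharge of Tao's pressure-normalisation lemma
(`FluidPDE/NormalisedPressureProofs`, Tao 2011 Lemma 4.1 (i)). For a velocity slice
`v : ℝ³ → ℝ³` of class `C²` with finite energy we construct the potential

  `Q[v] := -(Γ₀ * G[v]) - (D²Γ∞) * (v ⊗ v)`,  `G[v] = ∂ᵢ∂ⱼ(vᵢvⱼ) = div((v·∇)v + (div v) v)`

(`Γ = Γ₀ + Γ∞` the near/far splitting of the Newtonian kernel of `NewtonKernel`; the first
term is an `L¹_c`-kernel against the smooth source, the second a bounded kernel against the
`L¹` tensor `v ⊗ v`), and prove: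

* for `v ∈ C⁴`: `Q[v] ∈ C²` and **`ΔQ[v] = -G[v]`** (Gilbarg–Trudinger Lemma 4.2 with (2.17):
  `Δ(Γ * g) = g`), from `Δ(Γ₀ * G) = G - λ * G` (`NewtonPotential.integral_newtonNear_mul_laplacian`)
  and `Δ((D²Γ∞) * (v ⊗ v)) = (D²λ) * (v ⊗ v) = λ * G` (two integrations by parts; `λ = ΔΓ∞`);
* for `v ∈ C²`: the **principal-value representation** `p.v.∫ K(x-y)(v y) dy = Q[v](x) + |v(x)|²/3`
  (`K(z)(a) = -D²Γ(z)(a,a)` the pressure kernel of `NormalisedPressure`; Gilbarg–Trudinger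
  (4.9)–(4.10) with the trace term `δᵢⱼ/3`), whence **`normalisedPressure v = Q[v]`**
  pointwise (Tao 2011, (35));
* independence of the cutoff scale, and the **duality/dilation bound**
  `|∫ Q[v](x) ψ(R⁻¹(x - x₀)) dx| ≤ M_ψ ‖v‖₂²` (Tao 2011, proof of Lemma 4.1: "by an integration
  by parts … from the finite energy nature … this expression goes to zero as `R → ∞`").

Differentiation under the integral sign: an `L¹` kernel vanishing off a ball against a `Cⁿ`
function is in `HarmonicProbe` (`contDiff_integral_smul_comp_sub`); a bounded `C²` kernel against
integrable operator-valued weights is done here (`contDiff_two_integral_clm_apply_comp_sub`).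
The size/measurability/truncated-integrability facts for the pressure kernel are the tree's
(`abs_pressureKernel_le`, `measurable_pressureKernel` in `TaoEnergyLocalisationPressure`;
`integrableOn_pressureKernel_compl_closedBall` in `NormalisedPressurePV`, which also discharges
F1 `hasPressurePV_of_contDiff` for `C¹` fields by the cancellation argument — the principal-value
statement proved here for `C²` fields is the different, representation-theoretic one,
identifying the limit with `Q[v] + |v|²/3`).

## References

* D. Gilbarg, N. S. Trudinger, *Elliptic partial differential equations of second order*
  (Springer, 2001 reprint), Lemma 4.1, Lemma 4.2, (2.17), (4.9)–(4.10).
* E. M. Stein, *Singular integrals and differentiability properties of functions* (1970),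
  Ch. III §1.
* T. Tao, *Localisation and compactness properties of the Navier–Stokes global regularity
  problem*, Anal. PDE 6 (2013) = arXiv:1108.1165, (35), (42) and §4, proof of Lemma 4.1.
-/

noncomputable section

open MeasureTheory Set Filter Metric Topology InnerProductSpace Function Real
open scoped RealInnerProductSpace Laplacian ContDiff ENNReal

namespace Literature.Analysis.FluidPDE

/-! (Differentiation under the integral sign for `L¹` kernels vanishing off a ball —
`contDiff_integral_smul_comp_sub`, `laplacian_integral_mul_comp_sub` — is in `FluidPDE/HarmonicProbe`.) -/

/-! ### Differentiation under the integral sign: bounded kernels against `L¹` weights -/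

section KernelBounded

variable {E : Type*} [NormedAddCommGroup E] [InnerProductSpace ℝ E] [FiniteDimensional ℝ E]
  [MeasurableSpace E] [BorelSpace E]
variable {F : Type*} [NormedAddCommGroup F] [NormedSpace ℝ F]
variable {G : Type*} [NormedAddCommGroup G] [NormedSpace ℝ G]

/-- Integrability of `y ↦ L(y)(Φ(x - y))` for bounded continuous `Φ` and integrable
operator-valued weights `L`. [folklore] -/
theorem integrable_clm_apply_comp_sub {Φ : E → F} {L : E → F →L[ℝ] G} (hΦ : Continuous Φ)
    {M₀ : ℝ} (hM₀ : ∀ z, ‖Φ z‖ ≤ M₀) (hLc : Continuous L) (hLi : Integrable L) (x : E) :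
    Integrable fun y => L y (Φ (x - y)) := by
  refine Integrable.mono' (hLi.norm.mul_const M₀)
    (hLc.clm_apply (hΦ.comp (continuous_const.sub continuous_id))).aestronglyMeasurable
    (Eventually.of_forall fun y => ?_)
  exact (ContinuousLinearMap.le_opNorm _ _).trans
    (mul_le_mul_of_nonneg_left (hM₀ _) (norm_nonneg _))

/-- **Continuity** of `x ↦ ∫ L(y)(Φ(x - y)) dy` for bounded continuous `Φ` and integrable
operator-valued weights `L` (dominated convergence). [folklore] -/
theorem continuous_integral_clm_apply_comp_sub {Φ : E → F} {L : E → F →L[ℝ] G}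
    (hΦ : Continuous Φ) {M₀ : ℝ} (hM₀ : ∀ z, ‖Φ z‖ ≤ M₀) (hLc : Continuous L)
    (hLi : Integrable L) : Continuous fun x => ∫ y, L y (Φ (x - y)) := by
  refine continuous_of_dominated (bound := fun y => ‖L y‖ * M₀) ?_ ?_ ?_ ?_
  · exact fun x => (hLc.clm_apply (hΦ.comp (continuous_const.sub continuous_id))).aestronglyMeasurable
  · exact fun x => Eventually.of_forall fun y => (ContinuousLinearMap.le_opNorm _ _).trans
      (mul_le_mul_of_nonneg_left (hM₀ _) (norm_nonneg _))
  · exact hLi.norm.mul_const M₀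
  · exact Eventually.of_forall fun y =>
      (L y).continuous.comp (hΦ.comp (continuous_id.sub continuous_const))

/-- **Differentiation under the integral sign** for `x ↦ ∫ L(y)(Φ(x - y)) dy` with `Φ ∈ C¹`,
`Φ` and `DΦ` bounded, and integrable operator-valued weights `L`: the derivative is
`∫ L(y) ∘ DΦ(x - y) dy`. [folklore] -/
theorem hasFDerivAt_integral_clm_apply_comp_sub {Φ : E → F} {L : E → F →L[ℝ] G}
    (hΦ : ContDiff ℝ 1 Φ) {M₀ M₁ : ℝ} (hM₀ : ∀ z, ‖Φ z‖ ≤ M₀) (hM₁ : ∀ z, ‖fderiv ℝ Φ z‖ ≤ M₁)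
    (hLc : Continuous L) (hLi : Integrable L) (x₀ : E) :
    HasFDerivAt (fun x => ∫ y, L y (Φ (x - y))) (∫ y, (L y).comp (fderiv ℝ Φ (x₀ - y))) x₀ := by
  have hΦc : Continuous Φ := hΦ.continuous
  have hDΦ : Continuous (fderiv ℝ Φ) := hΦ.continuous_fderiv one_ne_zero
  refine hasFDerivAt_integral_of_dominated_of_fderiv_le
    (F' := fun x y => (L y).comp (fderiv ℝ Φ (x - y)))
    (bound := fun y => ‖L y‖ * M₁) univ_mem ?_ ?_ ?_ ?_ ?_ ?_
  · exact Eventually.of_forall fun x =>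
      (hLc.clm_apply (hΦc.comp (continuous_const.sub continuous_id))).aestronglyMeasurable
  · exact integrable_clm_apply_comp_sub hΦc hM₀ hLc hLi x₀
  · exact (hLc.clm_comp (hDΦ.comp (continuous_const.sub continuous_id))).aestronglyMeasurable
  · exact Eventually.of_forall fun y x _ => (ContinuousLinearMap.opNorm_comp_le _ _).trans
      (mul_le_mul_of_nonneg_left (hM₁ _) (norm_nonneg _))
  · exact hLi.norm.mul_const M₁
  · refine Eventually.of_forall fun y x _ => ?_
    have h1 : HasFDerivAt (fun x : E => Φ (x - y)) (fderiv ℝ Φ (x - y)) x := by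
      have := ((hΦ.differentiable one_ne_zero) (x - y)).hasFDerivAt.comp x
        (hasFDerivAt_sub_const y)
      rwa [ContinuousLinearMap.comp_id] at this
    exact (L y).hasFDerivAt.comp x h1

/-- The directional derivative formula
`∂ₐ ∫ L(y)(Φ(x - y)) dy = ∫ L(y)(DΦ(x - y) a) dy`. [folklore] -/
theorem fderiv_integral_clm_apply_comp_sub_apply [CompleteSpace G] {Φ : E → F}
    {L : E → F →L[ℝ] G}
    (hΦ : ContDiff ℝ 1 Φ) {M₀ M₁ : ℝ} (hM₀ : ∀ z, ‖Φ z‖ ≤ M₀) (hM₁ : ∀ z, ‖fderiv ℝ Φ z‖ ≤ M₁)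
    (hLc : Continuous L) (hLi : Integrable L) (x a : E) :
    fderiv ℝ (fun x => ∫ y, L y (Φ (x - y))) x a = ∫ y, L y (fderiv ℝ Φ (x - y) a) := by
  rw [(hasFDerivAt_integral_clm_apply_comp_sub hΦ hM₀ hM₁ hLc hLi x).fderiv,
    ContinuousLinearMap.integral_apply]
  · rfl
  · refine Integrable.mono' (hLi.norm.mul_const M₁)
      (hLc.clm_comp ((hΦ.continuous_fderiv one_ne_zero).comp
        (continuous_const.sub continuous_id))).aestronglyMeasurable
      (Eventually.of_forall fun y => (ContinuousLinearMap.opNorm_comp_le _ _).trans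
        (mul_le_mul_of_nonneg_left (hM₁ _) (norm_nonneg _)))

-- nested operator types `(E →L[ℝ] F) →L[ℝ] E →L[ℝ] G`
set_option maxSynthPendingDepth 3 in
/-- **`C²` regularity** of `x ↦ ∫ L(y)(Φ(x - y)) dy` for `Φ ∈ C²` with `Φ`, `DΦ`, `D²Φ` bounded
and integrable operator-valued weights, together with the formula for the pure second
derivatives: `∂ₐ∂ₐ ∫ L(y)(Φ(x - y)) dy = ∫ L(y)(D²Φ(x - y)(a, a)) dy`. [folklore] -/
theorem contDiff_two_integral_clm_apply_comp_sub [CompleteSpace G] {Φ : E → F}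
    {L : E → F →L[ℝ] G}
    (hΦ : ContDiff ℝ 2 Φ) {M₀ M₁ M₂ : ℝ} (hM₀ : ∀ z, ‖Φ z‖ ≤ M₀) (hM₁ : ∀ z, ‖fderiv ℝ Φ z‖ ≤ M₁)
    (hM₂ : ∀ z, ‖fderiv ℝ (fderiv ℝ Φ) z‖ ≤ M₂) (hLc : Continuous L) (hLi : Integrable L) :
    ContDiff ℝ 2 (fun x => ∫ y, L y (Φ (x - y))) ∧
      ∀ x a, fderiv ℝ (fun x' => fderiv ℝ (fun x => ∫ y, L y (Φ (x - y))) x' a) x a =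
        ∫ y, L y (fderiv ℝ (fderiv ℝ Φ) (x - y) a a) := by
  have hΦ1 : ContDiff ℝ 1 Φ := hΦ.of_le one_le_two
  have hDΦ : ContDiff ℝ 1 (fderiv ℝ Φ) := hΦ.fderiv_right (m := 1) le_rfl
  -- the directional derivatives of `Φ`
  have hΦa : ∀ a, ContDiff ℝ 1 fun z => fderiv ℝ Φ z a := fun a => hDΦ.clm_apply contDiff_const
  have hΦa0 : ∀ a z, ‖fderiv ℝ Φ z a‖ ≤ M₁ * ‖a‖ := fun a z =>
    (ContinuousLinearMap.le_opNorm _ _).trans (mul_le_mul_of_nonneg_right (hM₁ z) (norm_nonneg _))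
  have hM₂0 : 0 ≤ M₂ := (norm_nonneg _).trans (hM₂ 0)
  have hΦa1 : ∀ a z, ‖fderiv ℝ (fun z => fderiv ℝ Φ z a) z‖ ≤ M₂ * ‖a‖ := fun a z => by
    have hd : DifferentiableAt ℝ (fderiv ℝ Φ) z := (hDΦ.differentiable one_ne_zero) z
    rw [fderiv_clm_apply hd (differentiableAt_const a)]
    simp only [fderiv_fun_const, Pi.zero_apply, ContinuousLinearMap.comp_zero, zero_add]
    refine ContinuousLinearMap.opNorm_le_bound _ (by positivity) fun w => ?_
    rw [ContinuousLinearMap.flip_apply]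
    calc ‖fderiv ℝ (fderiv ℝ Φ) z w a‖ ≤ ‖fderiv ℝ (fderiv ℝ Φ) z w‖ * ‖a‖ :=
          ContinuousLinearMap.le_opNorm _ _
      _ ≤ ‖fderiv ℝ (fderiv ℝ Φ) z‖ * ‖w‖ * ‖a‖ := by
          gcongr; exact ContinuousLinearMap.le_opNorm _ _
      _ ≤ M₂ * ‖w‖ * ‖a‖ := by gcongr; exact hM₂ z
      _ = M₂ * ‖a‖ * ‖w‖ := by ring
  -- first derivatives
  have hD1 : ∀ x, HasFDerivAt (fun x => ∫ y, L y (Φ (x - y)))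
      (∫ y, (L y).comp (fderiv ℝ Φ (x - y))) x :=
    fun x => hasFDerivAt_integral_clm_apply_comp_sub hΦ1 hM₀ hM₁ hLc hLi x
  have hfa : ∀ a, (fun x => fderiv ℝ (fun x => ∫ y, L y (Φ (x - y))) x a) =
      fun x => ∫ y, L y ((fun z => fderiv ℝ Φ z a) (x - y)) := fun a =>
    funext fun x => fderiv_integral_clm_apply_comp_sub_apply hΦ1 hM₀ hM₁ hLc hLi x a
  -- second derivatives
  have hD2 : ∀ a x, HasFDerivAt (fun x => ∫ y, L y ((fun z => fderiv ℝ Φ z a) (x - y)))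
      (∫ y, (L y).comp (fderiv ℝ (fun z => fderiv ℝ Φ z a) (x - y))) x := fun a x =>
    hasFDerivAt_integral_clm_apply_comp_sub (hΦa a) (hΦa0 a) (hΦa1 a) hLc hLi x
  -- continuity of the second derivatives: again a parametric integral of the same shape
  have hL'c : Continuous fun y => (ContinuousLinearMap.compL ℝ E F G) (L y) :=
    (ContinuousLinearMap.compL ℝ E F G).continuous.comp hLc
  have hL'i : Integrable fun y => (ContinuousLinearMap.compL ℝ E F G) (L y) :=
    (ContinuousLinearMap.compL ℝ E F G).integrable_comp hLi
  have hcont2 : ∀ a, Continuous fun x =>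
      ∫ y, (L y).comp (fderiv ℝ (fun z => fderiv ℝ Φ z a) (x - y)) := fun a => by
    have := continuous_integral_clm_apply_comp_sub (Φ := fderiv ℝ (fun z => fderiv ℝ Φ z a))
      (L := fun y => (ContinuousLinearMap.compL ℝ E F G) (L y))
      ((hΦa a).continuous_fderiv one_ne_zero) (hΦa1 a) hL'c hL'i
    simpa using this
  refine ⟨?_, fun x a => ?_⟩
  · rw [show (2 : WithTop ℕ∞) = 1 + 1 from rfl, contDiff_succ_iff_fderiv_apply]
    refine ⟨fun x => (hD1 x).differentiableAt, fun h => absurd h (by norm_cast), fun a => ?_⟩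
    rw [hfa a, contDiff_one_iff_fderiv]
    refine ⟨fun x => (hD2 a x).differentiableAt, ?_⟩
    have : fderiv ℝ (fun x => ∫ y, L y ((fun z => fderiv ℝ Φ z a) (x - y))) =
        fun x => ∫ y, (L y).comp (fderiv ℝ (fun z => fderiv ℝ Φ z a) (x - y)) :=
      funext fun x => (hD2 a x).fderiv
    rw [this]
    exact hcont2 a
  · rw [hfa a, fderiv_integral_clm_apply_comp_sub_apply (hΦa a) (hΦa0 a) (hΦa1 a) hLc hLi x a]
    refine integral_congr_ae (Eventually.of_forall fun y => ?_)
    have hd : DifferentiableAt ℝ (fderiv ℝ Φ) (x - y) := (hDΦ.differentiable one_ne_zero) _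
    simp only
    rw [fderiv_clm_apply hd (differentiableAt_const a)]
    simp

end KernelBounded

/-! ### Algebra of directional derivatives -/

section Partial

variable {E : Type*} [NormedAddCommGroup E] [InnerProductSpace ℝ E] [FiniteDimensional ℝ E]
variable {F' : Type*} [NormedAddCommGroup F'] [InnerProductSpace ℝ F']

omit [FiniteDimensional ℝ E] in
/-- `∂ₐ` lowers the differentiability class by one. [folklore] -/
theorem contDiff_partialDeriv {φ : E → F'} {n : ℕ∞} (hφ : ContDiff ℝ (n + 1) φ) (a : E) :
    ContDiff ℝ n (FluidPDE.partialDeriv a φ) :=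
  (hφ.fderiv_right (m := n) le_rfl).clm_apply contDiff_const

omit [FiniteDimensional ℝ E] in
/-- **Schwarz**: `∂ₐ∂_c φ = ∂_c∂ₐ φ` for `φ ∈ C²` (Mathlib `ContDiffAt.isSymmSndFDerivAt`). [folklore] -/
theorem partialDeriv_comm {φ : E → F'} (hφ : ContDiff ℝ 2 φ) (a c : E) :
    FluidPDE.partialDeriv a (FluidPDE.partialDeriv c φ) = FluidPDE.partialDeriv c (FluidPDE.partialDeriv a φ) := by
  have hD : Differentiable ℝ (fderiv ℝ φ) :=
    (hφ.fderiv_right (m := 1) le_rfl).differentiable one_ne_zero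
  have h22 : minSmoothness ℝ 2 ≤ (2 : ℕ∞ω) := by
    rw [minSmoothness_of_isRCLikeNormedField]
  funext x
  show fderiv ℝ (fun y => fderiv ℝ φ y c) x a = fderiv ℝ (fun y => fderiv ℝ φ y a) x c
  rw [FluidPDE.fderiv_apply_const_apply (hD x), FluidPDE.fderiv_apply_const_apply (hD x)]
  exact (hφ.contDiffAt.isSymmSndFDerivAt h22).eq a c

omit [FiniteDimensional ℝ E] in
/-- `∂ₐ` of a finite sum of differentiable functions. [folklore] -/
theorem partialDeriv_sum {ι : Type*} (s : Finset ι) {φ : ι → E → F'}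
    (h : ∀ i, Differentiable ℝ (φ i)) (a : E) :
    FluidPDE.partialDeriv a (fun x => ∑ i ∈ s, φ i x) = fun x => ∑ i ∈ s, FluidPDE.partialDeriv a (φ i) x := by
  funext x
  simp only [FluidPDE.partialDeriv]
  rw [fderiv_fun_sum fun i _ => h i x, _root_.FunLike.coe_sum, Finset.sum_apply]

/-- The Laplacian as iterated directional derivatives: `Δφ = Σᵢ ∂ᵢ∂ᵢφ` (as functions). [folklore] -/
theorem laplacian_eq_sum_partialDeriv {ι : Type*} [Fintype ι] (b : OrthonormalBasis ι ℝ E)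
    {φ : E → F'} (hφ : ContDiff ℝ 2 φ) :
    Δ φ = fun x => ∑ i, FluidPDE.partialDeriv (b i) (FluidPDE.partialDeriv (b i) φ) x :=
  funext fun x => FluidPDE.laplacian_eq_sum_fderiv_fderiv b hφ x

/-- **`Δ ∂ₐ∂ₐ = ∂ₐ∂ₐ Δ` on `C⁴` functions** (four applications of Schwarz). [folklore] -/
theorem laplacian_partialDeriv_partialDeriv {φ : E → F'} (hφ : ContDiff ℝ 4 φ) (a x : E) :
    Δ (FluidPDE.partialDeriv a (FluidPDE.partialDeriv a φ)) x =
      FluidPDE.partialDeriv a (FluidPDE.partialDeriv a (Δ φ)) x := by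
  set b := stdOrthonormalBasis ℝ E
  -- differentiability classes of the iterated partials
  have hφ3 : ContDiff ℝ 3 φ := hφ.of_le (by norm_num)
  have hφ2 : ContDiff ℝ 2 φ := hφ.of_le (by norm_num)
  have hP1 : ∀ c, ContDiff ℝ 3 (FluidPDE.partialDeriv c φ) := fun c =>
    contDiff_partialDeriv (n := 3) hφ c
  have hP2 : ∀ c d, ContDiff ℝ 2 (FluidPDE.partialDeriv c (FluidPDE.partialDeriv d φ)) := fun c d =>
    contDiff_partialDeriv (n := 2) (hP1 d) c
  have hP3 : ∀ c d e, ContDiff ℝ 1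
      (FluidPDE.partialDeriv c (FluidPDE.partialDeriv d (FluidPDE.partialDeriv e φ))) := fun c d e =>
    contDiff_partialDeriv (n := 1) (hP2 d e) c
  -- left-hand side
  rw [FluidPDE.laplacian_eq_sum_fderiv_fderiv b (hP2 a a) x]
  -- right-hand side: push `∂ₐ∂ₐ` through the sum
  have hΔ : Δ φ = fun y => ∑ i, FluidPDE.partialDeriv (b i) (FluidPDE.partialDeriv (b i) φ) y :=
    laplacian_eq_sum_partialDeriv b hφ2
  have hs1 : FluidPDE.partialDeriv a (Δ φ) =
      fun y => ∑ i, FluidPDE.partialDeriv a (FluidPDE.partialDeriv (b i) (FluidPDE.partialDeriv (b i) φ)) y := by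
    rw [hΔ]
    exact partialDeriv_sum _ (fun i => (hP2 (b i) (b i)).differentiable two_ne_zero) a
  have hs2 : FluidPDE.partialDeriv a (FluidPDE.partialDeriv a (Δ φ)) = fun y => ∑ i, FluidPDE.partialDeriv a
      (FluidPDE.partialDeriv a (FluidPDE.partialDeriv (b i) (FluidPDE.partialDeriv (b i) φ))) y := by
    rw [hs1]
    exact partialDeriv_sum _ (fun i => (hP3 a (b i) (b i)).differentiable one_ne_zero) a
  rw [hs2]
  refine Finset.sum_congr rfl fun i _ => ?_
  -- four Schwarz swaps: `∂ᵢ∂ᵢ∂ₐ∂ₐφ = ∂ₐ∂ₐ∂ᵢ∂ᵢφ`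
  change FluidPDE.partialDeriv (b i) (FluidPDE.partialDeriv (b i)
    (FluidPDE.partialDeriv a (FluidPDE.partialDeriv a φ))) x = _
  have e1 : FluidPDE.partialDeriv (b i) (FluidPDE.partialDeriv a (FluidPDE.partialDeriv a φ)) =
      FluidPDE.partialDeriv a (FluidPDE.partialDeriv (b i) (FluidPDE.partialDeriv a φ)) :=
    partialDeriv_comm ((hP1 a).of_le (by norm_num)) (b i) a
  have e2 : FluidPDE.partialDeriv (b i) (FluidPDE.partialDeriv a φ) =
      FluidPDE.partialDeriv a (FluidPDE.partialDeriv (b i) φ) := partialDeriv_comm hφ2 (b i) a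
  have e3 : FluidPDE.partialDeriv (b i) (FluidPDE.partialDeriv a
      (FluidPDE.partialDeriv a (FluidPDE.partialDeriv (b i) φ))) = FluidPDE.partialDeriv a
      (FluidPDE.partialDeriv (b i) (FluidPDE.partialDeriv a (FluidPDE.partialDeriv (b i) φ))) :=
    partialDeriv_comm (hP2 a (b i)) (b i) a
  have e4 : FluidPDE.partialDeriv (b i) (FluidPDE.partialDeriv a (FluidPDE.partialDeriv (b i) φ)) =
      FluidPDE.partialDeriv a (FluidPDE.partialDeriv (b i) (FluidPDE.partialDeriv (b i) φ)) :=
    partialDeriv_comm ((hP1 (b i)).of_le (by norm_num)) (b i) a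
  rw [e1, e2, e3, e4]

end Partial

/-! ### The quadratic source `∂ᵢ∂ⱼ(vᵢvⱼ)` and the double integration by parts -/

section Source

variable {E : Type*} [NormedAddCommGroup E] [InnerProductSpace ℝ E] [FiniteDimensional ℝ E]

/-- **The quadratic source** `G[v] = ∂ᵢ∂ⱼ(vᵢvⱼ) = div((v·∇)v + (div v) v)` (basis-free:
`∂ⱼ(vᵢvⱼ) = vⱼ∂ⱼvᵢ + vᵢ∂ⱼvⱼ`), the right-hand side of the pressure Poisson equation
`-Δp = ∂ᵢ∂ⱼ(vᵢvⱼ)` (Tao 2011, (8)). [folklore] -/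
def pressureSource (v : E → E) (x : E) : ℝ :=
  VectorCalculus.divergence (fun y => FluidPDE.convect v v y + VectorCalculus.divergence v y • v y) x

omit [FiniteDimensional ℝ E] in
/-- Unfolding `pressureSource`. [folklore] -/
theorem pressureSource_def (v : E → E) :
    pressureSource v = VectorCalculus.divergence fun y => FluidPDE.convect v v y + VectorCalculus.divergence v y • v y :=
  rfl

omit [FiniteDimensional ℝ E] in
/-- For a divergence-free field, `G[v] = div((v·∇)v)`. [folklore] -/
theorem pressureSource_eq_of_isDivFree {v : E → E} (hdiv : VectorCalculus.IsDivFree v) :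
    pressureSource v = VectorCalculus.divergence (FluidPDE.convect v v) := by
  have : (fun y => FluidPDE.convect v v y + VectorCalculus.divergence v y • v y) = FluidPDE.convect v v := by
    funext y
    rw [hdiv y, zero_smul, add_zero]
  rw [pressureSource_def, this]

omit [FiniteDimensional ℝ E] in
/-- `(v·∇)v` lowers the differentiability class by one. [folklore] -/
theorem contDiff_convect_self {v : E → E} {n : ℕ∞} (hv : ContDiff ℝ (n + 1) v) :
    ContDiff ℝ n (FluidPDE.convect v v) := by
  have : FluidPDE.convect v v = fun x => fderiv ℝ v x (v x) := rfl
  rw [this]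
  exact (hv.fderiv_right (m := n) le_rfl).clm_apply (hv.of_le le_self_add)

/-- `G[v] ∈ Cⁿ` for `v ∈ Cⁿ⁺²`. [folklore] -/
theorem contDiff_pressureSource {v : E → E} {n : ℕ∞} (hv : ContDiff ℝ (n + 2) v) :
    ContDiff ℝ n (pressureSource v) := by
  have hv' : ContDiff ℝ (n + 1 + 1) v := by
    rwa [add_assoc, show (1 : WithTop ℕ∞) + 1 = 2 from rfl]
  have hW : ContDiff ℝ (n + 1) fun y => FluidPDE.convect v v y + VectorCalculus.divergence v y • v y :=
    (contDiff_convect_self hv').add ((FluidPDE.contDiff_divergence hv').smul (hv'.of_le le_self_add))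
  exact FluidPDE.contDiff_divergence hW

variable [MeasurableSpace E] [BorelSpace E]

/-- **Double integration by parts**: for `θ ∈ C²_c(E)` and `v ∈ C²(E; E)`,
`∫ θ ∂ᵢ∂ⱼ(vᵢvⱼ) = ∫ ∂ᵢ∂ⱼθ vᵢvⱼ`, i.e. `∫ θ G[v] = ∫ D²θ(y)(v y, v y) dy` (Leray 1934, §6 (1.11)
twice; no boundary terms since `θ` has compact support). [folklore] -/
theorem integral_mul_pressureSource {θ : E → ℝ} {v : E → E} (hθ : ContDiff ℝ 2 θ)
    (hc : HasCompactSupport θ) (hv : ContDiff ℝ 2 v) :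
    ∫ y, θ y * pressureSource v y = ∫ y, fderiv ℝ (fderiv ℝ θ) y (v y) (v y) := by
  haveI : CompleteSpace E := FiniteDimensional.complete ℝ E
  have hθ1 : ContDiff ℝ 1 θ := hθ.of_le one_le_two
  have hv1 : ContDiff ℝ 1 v := hv.of_le one_le_two
  have hv2 : ContDiff ℝ ((1 : ℕ∞) + 1) v := by exact_mod_cast hv
  have hDθ : ContDiff ℝ 1 (fderiv ℝ θ) := hθ.fderiv_right (m := 1) le_rfl
  -- the vector field `W = (v·∇)v + (div v) v` and the scalar `β = Dθ(v)`
  set W : E → E := fun y => FluidPDE.convect v v y + VectorCalculus.divergence v y • v y with hW_def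
  have hW : ContDiff ℝ 1 W :=
    (contDiff_convect_self hv2).add ((FluidPDE.contDiff_divergence hv2).smul hv1)
  set β : E → ℝ := fun y => fderiv ℝ θ y (v y) with hβ_def
  have hβ : ContDiff ℝ 1 β := hDθ.clm_apply hv1
  have hK : IsCompact (tsupport θ) := hc
  have hθ0 : ∀ y ∉ tsupport θ, fderiv ℝ θ y = 0 := fun y hy => fderiv_of_notMem_tsupport ℝ hy
  have hθ00 : ∀ y ∉ tsupport θ, fderiv ℝ (fderiv ℝ θ) y = 0 := fun y hy =>
    fderiv_of_notMem_tsupport ℝ fun h => hy (tsupport_fderiv_subset ℝ h)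
  have hβc : HasCompactSupport β := HasCompactSupport.intro hK fun y hy => by
    simp [hβ_def, hθ0 y hy]
  -- first integration by parts
  have h1 := FluidPDE.integral_mul_divergence_add_eq_zero_left hθ1 hW hc
  -- second integration by parts: `∫ div(β v) = 0`
  have h2 := FluidPDE.integral_divergence_eq_zero (w := fun y => β y • v y) (hβ.smul hv1)
    (hβc.smul_right)
  -- pointwise identities
  have hgradθ : ∀ y, ⟪W y, gradient θ y⟫ =
      fderiv ℝ θ y (FluidPDE.convect v v y) + VectorCalculus.divergence v y * β y := fun y => by
    rw [FluidPDE.inner_gradient_eq_fderiv_apply]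
    simp [hW_def, hβ_def]
  have hdivβ : ∀ y, VectorCalculus.divergence (fun y => β y • v y) y =
      ⟪W y, gradient θ y⟫ + fderiv ℝ (fderiv ℝ θ) y (v y) (v y) := fun y => by
    have hβd : DifferentiableAt ℝ β y := hβ.differentiable one_ne_zero y
    have hvd : DifferentiableAt ℝ v y := hv1.differentiable one_ne_zero y
    have hDθd : DifferentiableAt ℝ (fderiv ℝ θ) y := hDθ.differentiable one_ne_zero y
    rw [FluidPDE.divergence_smul_apply hβd hvd, FluidPDE.inner_gradient_eq_fderiv_apply, hgradθ y]
    have : fderiv ℝ β y (v y) =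
        fderiv ℝ θ y (fderiv ℝ v y (v y)) + fderiv ℝ (fderiv ℝ θ) y (v y) (v y) := by
      rw [hβ_def, fderiv_clm_apply hDθd hvd]
      simp
    rw [this]
    simp only [FluidPDE.convect]
    ring
  -- integrability
  have hWc : Continuous W := hW.continuous
  have iA : Integrable (fun y => ⟪W y, gradient θ y⟫) := by
    refine (hWc.inner (FluidPDE.continuous_gradient_of_contDiff hθ1)).integrable_of_hasCompactSupport
      (HasCompactSupport.intro hK fun y hy => ?_)
    rw [FluidPDE.gradient_eq_zero_of_notMem_tsupport hy, inner_zero_right]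
  have iB : Integrable (fun y => fderiv ℝ (fderiv ℝ θ) y (v y) (v y)) := by
    refine ((((hDθ.continuous_fderiv one_ne_zero).clm_apply hv.continuous).clm_apply
      hv.continuous)).integrable_of_hasCompactSupport (HasCompactSupport.intro hK fun y hy => ?_)
    simp [hθ00 y hy]
  have h3 : ∫ y, VectorCalculus.divergence (fun y => β y • v y) y =
      (∫ y, ⟪W y, gradient θ y⟫) + ∫ y, fderiv ℝ (fderiv ℝ θ) y (v y) (v y) := by
    rw [← integral_add iA iB]
    exact integral_congr_ae (Eventually.of_forall hdivβ)
  have h4 : ∫ y, θ y * pressureSource v y = ∫ y, θ y * VectorCalculus.divergence W y := rfl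
  rw [h4]
  linarith [h1, h2, h3]

/-- Translated form of the double integration by parts:
`∫ φ(x - y) G[v](y) dy = ∫ D²φ(x - y)(v y, v y) dy` for `φ ∈ C²_c`, `v ∈ C²`. [folklore] -/
theorem integral_comp_sub_mul_pressureSource {φ : E → ℝ} {v : E → E} (hφ : ContDiff ℝ 2 φ)
    (hc : HasCompactSupport φ) (hv : ContDiff ℝ 2 v) (x : E) :
    ∫ y, φ (x - y) * pressureSource v y = ∫ y, fderiv ℝ (fderiv ℝ φ) (x - y) (v y) (v y) := by
  have hθ : ContDiff ℝ 2 fun y => φ (x - y) := hφ.comp (contDiff_const.sub contDiff_id)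
  have hθc : HasCompactSupport fun y => φ (x - y) := hc.comp_homeomorph (Homeomorph.subLeft x)
  rw [integral_mul_pressureSource hθ hθc hv]
  refine integral_congr_ae (Eventually.of_forall fun y => ?_)
  simp only
  rw [fderiv2_comp_const_sub]

end Source

/-! ### The potentials on `ℝ³` -/

section R3

-- nested operator types `ℝ³ →L[ℝ] ℝ³ →L[ℝ] ℝ³ →L[ℝ] ℝ`
set_option maxSynthPendingDepth 3

/-- Local notation for physical space `ℝ³ = EuclideanSpace ℝ (Fin 3)`. -/
local notation "ℝ³" => EuclideanSpace ℝ (Fin 3)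

variable {r₀ r₁ : ℝ}

/-- **The near potential** `Q₁[v](x) = (Γ₀ * G[v])(x) = ∫ Γ₀(z) G[v](x - z) dz` (absolutely
convergent: `Γ₀ ∈ L¹` with compact support, `G[v]` continuous). [folklore] -/
def nearPotential (r₀ r₁ : ℝ) (v : ℝ³ → ℝ³) (x : ℝ³) : ℝ :=
  ∫ z, newtonNear r₀ r₁ z * pressureSource v (x - z)

/-- **The far potential** `Q₂[v](x) = ((D²Γ∞) * (v ⊗ v))(x) = ∫ D²Γ∞(x - y)(v y, v y) dy`
(absolutely convergent: `D²Γ∞` bounded, `|v|² ∈ L¹`). [folklore] -/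
def farPotential (r₀ r₁ : ℝ) (v : ℝ³ → ℝ³) (x : ℝ³) : ℝ :=
  ∫ y, fderiv ℝ (fderiv ℝ (newtonFar r₀ r₁)) (x - y) (v y) (v y)

/-- **The pressure potential** `Q[v] = -Q₁[v] - Q₂[v]` (cutoff radii `1, 2`), the candidate for
`-Δ⁻¹∂ᵢ∂ⱼ(vᵢvⱼ)`: `ΔQ[v] = -G[v]` (`laplacian_pressurePotential`) and `Q[v]` is the normalised
pressure of Tao 2011, (35) (`normalisedPressure_eq_pressurePotential`). [folklore] -/
def pressurePotential (v : ℝ³ → ℝ³) (x : ℝ³) : ℝ :=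
  -nearPotential 1 2 v x - farPotential 1 2 v x

/-! #### The near potential -/

/-- **`Q₁[v] ∈ Cⁿ` for `v ∈ Cⁿ⁺²`** (differentiation under the integral sign against the
`L¹` kernel `Γ₀`). [folklore] -/
theorem contDiff_nearPotential (h₀ : 0 ≤ r₀) (h₁ : r₀ < r₁) (n : ℕ) {v : ℝ³ → ℝ³}
    (hv : ContDiff ℝ (n + 2) v) : ContDiff ℝ n (nearPotential r₀ r₁ v) := by
  have hG : ContDiff ℝ n (pressureSource v) := contDiff_pressureSource (by exact_mod_cast hv)
  exact contDiff_integral_smul_comp_sub (integrable_newtonNear h₀ h₁)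
    (fun z hz => newtonNear_eq_zero h₀ h₁ hz.le) n hG

/-- **`ΔQ₁[v] = G[v] - λ * G[v]`** for `v ∈ C⁴` (`Δ` under the integral, then
`∫ Γ₀ Δφ = φ(0) - ∫ λ φ` with `φ = G[v](x - ·)`). [cite: GilbargTrudinger2001, (2.17)] -/
theorem laplacian_nearPotential (h₀ : 0 < r₀) (h₁ : r₀ < r₁) {v : ℝ³ → ℝ³}
    (hv : ContDiff ℝ 4 v) (x : ℝ³) :
    Δ (nearPotential r₀ r₁ v) x =
      pressureSource v x - ∫ z, newtonFarLaplacian r₀ r₁ z * pressureSource v (x - z) := by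
  have hG : ContDiff ℝ 2 (pressureSource v) := contDiff_pressureSource (by exact_mod_cast hv)
  have h1 := laplacian_integral_mul_comp_sub (integrable_newtonNear h₀.le h₁)
    (fun z hz => newtonNear_eq_zero h₀.le h₁ hz.le) hG x
  change Δ (fun x => ∫ z, newtonNear r₀ r₁ z * pressureSource v (x - z)) x = _
  rw [h1]
  have hφ : ContDiff ℝ 2 fun z => pressureSource v (x - z) :=
    hG.comp (contDiff_const.sub contDiff_id)
  have h2 := integral_newtonNear_mul_laplacian h₀ h₁ hφ
  simp only [laplacian_comp_const_sub, sub_zero] at h2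
  exact h2

/-! #### The far potential -/

/-- Evaluation of a bilinear form on the diagonal, `B ↦ B(a, a)`, as a continuous linear
functional. [folklore] -/
def evalDiag (a : ℝ³) : (ℝ³ →L[ℝ] ℝ³ →L[ℝ] ℝ) →L[ℝ] ℝ :=
  (ContinuousLinearMap.apply ℝ ℝ a).comp (ContinuousLinearMap.apply ℝ (ℝ³ →L[ℝ] ℝ) a)

/-- Unfolding `evalDiag`. [folklore] -/
@[simp] theorem evalDiag_apply (a : ℝ³) (B : ℝ³ →L[ℝ] ℝ³ →L[ℝ] ℝ) : evalDiag a B = B a a :=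
  rfl

/-- `a ↦ evalDiag a` is continuous. [folklore] -/
theorem continuous_evalDiag : Continuous (evalDiag : ℝ³ → _) :=
  ((ContinuousLinearMap.apply ℝ ℝ).continuous).clm_comp
    ((ContinuousLinearMap.apply ℝ (ℝ³ →L[ℝ] ℝ)).continuous)

/-- `‖evalDiag a‖ ≤ ‖a‖²`. [folklore] -/
theorem norm_evalDiag_le (a : ℝ³) : ‖evalDiag a‖ ≤ ‖a‖ ^ 2 := by
  refine ContinuousLinearMap.opNorm_le_bound _ (by positivity) fun B => ?_
  rw [evalDiag_apply]
  calc ‖B a a‖ ≤ ‖B a‖ * ‖a‖ := ContinuousLinearMap.le_opNorm _ _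
    _ ≤ ‖B‖ * ‖a‖ * ‖a‖ := by gcongr; exact ContinuousLinearMap.le_opNorm _ _
    _ = ‖a‖ ^ 2 * ‖B‖ := by ring

/-- The weights `y ↦ evalDiag (v y)` are integrable when `|v|² ∈ L¹`. [folklore] -/
theorem integrable_evalDiag_comp {v : ℝ³ → ℝ³} (hv : Continuous v)
    (hL2 : Integrable fun y => ‖v y‖ ^ 2) : Integrable fun y => evalDiag (v y) :=
  Integrable.mono' hL2 (continuous_evalDiag.comp hv).aestronglyMeasurable
    (Eventually.of_forall fun y => norm_evalDiag_le (v y))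

/-- `∫ ‖evalDiag (v y)‖ dy ≤ ∫ |v|²`. [folklore] -/
theorem integral_norm_evalDiag_comp_le {v : ℝ³ → ℝ³} (hv : Continuous v)
    (hL2 : Integrable fun y => ‖v y‖ ^ 2) : ∫ y, ‖evalDiag (v y)‖ ≤ ∫ y, ‖v y‖ ^ 2 :=
  integral_mono (integrable_evalDiag_comp hv hL2).norm hL2 fun y => norm_evalDiag_le (v y)

/-- Bounds for `D²Γ∞`, `D³Γ∞`, `D⁴Γ∞` packaged for the parametric-integral lemmas. [folklore] -/
theorem exists_bounds_fderiv2_newtonFar (h₀ : 0 < r₀) (h₁ : r₀ < r₁) :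
    ∃ M₀ M₁ M₂ : ℝ, (∀ z, ‖fderiv ℝ (fderiv ℝ (newtonFar r₀ r₁)) z‖ ≤ M₀) ∧
      (∀ z, ‖fderiv ℝ (fderiv ℝ (fderiv ℝ (newtonFar r₀ r₁))) z‖ ≤ M₁) ∧
      (∀ z, ‖fderiv ℝ (fderiv ℝ (fderiv ℝ (fderiv ℝ (newtonFar r₀ r₁)))) z‖ ≤ M₂) := by
  obtain ⟨-, -, ⟨M₀, h0⟩, ⟨M₁, h1⟩, ⟨M₂, h2⟩⟩ := exists_bound_newtonFar_derivs h₀ h₁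
  exact ⟨M₀, M₁, M₂, h0, h1, h2⟩

/-- `D²Γ∞ ∈ C²`. [folklore] -/
theorem contDiff_fderiv2_newtonFar (h₀ : 0 < r₀) (h₁ : r₀ < r₁) :
    ContDiff ℝ 2 (fderiv ℝ (fderiv ℝ (newtonFar r₀ r₁))) :=
  ((contDiff_newtonFar h₀ h₁ (n := 4)).fderiv_right (m := 3) (by norm_num)).fderiv_right
    (m := 2) (by norm_num)

/-- The far potential in operator form: `Q₂[v](x) = ∫ evalDiag(v y) (D²Γ∞(x - y)) dy`. [folklore] -/
theorem farPotential_eq (r₀ r₁ : ℝ) (v : ℝ³ → ℝ³) :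
    farPotential r₀ r₁ v =
      fun x => ∫ y, evalDiag (v y) (fderiv ℝ (fderiv ℝ (newtonFar r₀ r₁)) (x - y)) :=
  rfl

/-- **The pointwise bound** `|Q₂[v](x)| ≤ M ∫|v|²` whenever `‖D²Γ∞‖ ≤ M`. [folklore] -/
theorem abs_farPotential_le {v : ℝ³ → ℝ³} (hL2 : Integrable fun y => ‖v y‖ ^ 2) {M : ℝ}
    (hM : ∀ z, ‖fderiv ℝ (fderiv ℝ (newtonFar r₀ r₁)) z‖ ≤ M) (x : ℝ³) :
    |farPotential r₀ r₁ v x| ≤ M * ∫ y, ‖v y‖ ^ 2 := by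
  have hM0 : 0 ≤ M := (norm_nonneg _).trans (hM 0)
  rw [farPotential, ← Real.norm_eq_abs, ← integral_const_mul]
  refine norm_integral_le_of_norm_le (hL2.const_mul M) (Eventually.of_forall fun y => ?_)
  rw [Real.norm_eq_abs]
  calc |fderiv ℝ (fderiv ℝ (newtonFar r₀ r₁)) (x - y) (v y) (v y)|
      ≤ ‖fderiv ℝ (fderiv ℝ (newtonFar r₀ r₁)) (x - y) (v y)‖ * ‖v y‖ := by
        rw [← Real.norm_eq_abs]; exact ContinuousLinearMap.le_opNorm _ _
    _ ≤ ‖fderiv ℝ (fderiv ℝ (newtonFar r₀ r₁)) (x - y)‖ * ‖v y‖ * ‖v y‖ := by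
        gcongr; exact ContinuousLinearMap.le_opNorm _ _
    _ ≤ M * ‖v y‖ * ‖v y‖ := by gcongr; exact hM _
    _ = M * ‖v y‖ ^ 2 := by ring

/-- **`Q₂[v] ∈ C²`** with the formula `∂ₐ∂ₐQ₂[v](x) = ∫ D⁴Γ∞(x - y)(a, a, v y, v y) dy`, for `v`
continuous with `|v|² ∈ L¹` (bounded kernels `D²Γ∞, D³Γ∞, D⁴Γ∞` against the integrable weights
`evalDiag (v y)`). [folklore] -/
theorem contDiff_farPotential (h₀ : 0 < r₀) (h₁ : r₀ < r₁) {v : ℝ³ → ℝ³} (hv : Continuous v)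
    (hL2 : Integrable fun y => ‖v y‖ ^ 2) :
    ContDiff ℝ 2 (farPotential r₀ r₁ v) ∧
      ∀ x a, fderiv ℝ (fun x' => fderiv ℝ (farPotential r₀ r₁ v) x' a) x a =
        ∫ y, fderiv ℝ (fderiv ℝ (fderiv ℝ (fderiv ℝ (newtonFar r₀ r₁)))) (x - y) a a (v y) (v y) := by
  obtain ⟨M₀, M₁, M₂, hM₀, hM₁, hM₂⟩ := exists_bounds_fderiv2_newtonFar h₀ h₁
  have h := contDiff_two_integral_clm_apply_comp_sub (L := fun y => evalDiag (v y))
    (contDiff_fderiv2_newtonFar h₀ h₁) hM₀ hM₁ hM₂ (continuous_evalDiag.comp hv)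
    (integrable_evalDiag_comp hv hL2)
  rw [farPotential_eq]
  refine ⟨h.1, fun x a => ?_⟩
  rw [h.2 x a]
  rfl

/-- The trace identity behind `ΔQ₂ = (D²λ) * (v ⊗ v)`:
`Σᵢ D⁴Γ∞(z)(eᵢ, eᵢ, a, a) = D²λ(z)(a, a)`, `λ = ΔΓ∞` (Schwarz, four times). [folklore] -/
theorem sum_fderiv4_newtonFar_apply (h₀ : 0 < r₀) (h₁ : r₀ < r₁) {ι : Type*} [Fintype ι]
    (b : OrthonormalBasis ι ℝ ℝ³) (z a : ℝ³) :
    ∑ i, fderiv ℝ (fderiv ℝ (fderiv ℝ (fderiv ℝ (newtonFar r₀ r₁)))) z (b i) (b i) a a =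
      fderiv ℝ (fderiv ℝ (newtonFarLaplacian r₀ r₁)) z a a := by
  set Γ := newtonFar r₀ r₁ with hΓ
  set Φ := fderiv ℝ (fderiv ℝ Γ) with hΦ
  have hΓs : ContDiff ℝ 4 Γ := contDiff_newtonFar h₀ h₁
  have hΦs : ContDiff ℝ 2 Φ := contDiff_fderiv2_newtonFar h₀ h₁
  have hDΓd : Differentiable ℝ (fderiv ℝ Γ) :=
    ((hΓs.fderiv_right (m := 3) (by norm_num)).differentiable (by norm_num))
  have hΦd : Differentiable ℝ Φ := hΦs.differentiable two_ne_zero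
  have hDΦd : Differentiable ℝ (fderiv ℝ Φ) :=
    (hΦs.fderiv_right (m := 1) le_rfl).differentiable one_ne_zero
  -- `Φ(·)(a, a) = ∂ₐ∂ₐΓ`
  have hPa : (fun w => Φ w a a) = FluidPDE.partialDeriv a (FluidPDE.partialDeriv a Γ) := by
    funext w
    change fderiv ℝ (fderiv ℝ Γ) w a a = fderiv ℝ (fun y => fderiv ℝ Γ y a) w a
    rw [FluidPDE.fderiv_apply_const_apply (hDΓd w)]
  have hPa2 : ContDiff ℝ 2 (FluidPDE.partialDeriv a (FluidPDE.partialDeriv a Γ)) :=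
    contDiff_partialDeriv (n := 2) (contDiff_partialDeriv (n := 3) hΓs a) a
  -- evaluation commutes with the two outer derivatives
  have hev : ∀ i, fderiv ℝ (fderiv ℝ Φ) z (b i) (b i) a a =
      fderiv ℝ (fun w => fderiv ℝ (fun w => Φ w a a) w (b i)) z (b i) := by
    intro i
    have e1 : (fun w => fderiv ℝ (fun w => Φ w a a) w (b i)) =
        fun w => evalDiag a (fderiv ℝ Φ w (b i)) := by
      funext w
      have : (fun w => Φ w a a) = fun w => evalDiag a (Φ w) := rfl
      rw [this, fderiv_clm_apply (differentiableAt_const _) (hΦd w)]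
      simp
    rw [e1, fderiv_clm_apply (differentiableAt_const _) ((hDΦd z).clm_apply
      (differentiableAt_const _))]
    simp only [fderiv_fun_const, Pi.zero_apply, ContinuousLinearMap.flip_zero,
      _root_.zero_apply, add_zero, ContinuousLinearMap.coe_comp, comp_apply,
      evalDiag_apply]
    rw [FluidPDE.fderiv_apply_const_apply (hDΦd z)]
  simp_rw [hev, hPa]
  rw [← FluidPDE.laplacian_eq_sum_fderiv_fderiv b hPa2 z, laplacian_partialDeriv_partialDeriv hΓs,
    newtonFarLaplacian]
  change fderiv ℝ (fun y => fderiv ℝ (Δ Γ) y a) z a = _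
  have hΔd : Differentiable ℝ (fderiv ℝ (Δ Γ)) := by
    have : ContDiff ℝ 2 (Δ Γ) := contDiff_laplacian (by exact_mod_cast hΓs)
    exact (this.fderiv_right (m := 1) le_rfl).differentiable one_ne_zero
  rw [FluidPDE.fderiv_apply_const_apply (hΔd z)]

/-- **`ΔQ₂[v] = λ * G[v]`** for `v ∈ C²` with `|v|² ∈ L¹`: the Laplacian falls on the smooth
kernel, `Δ D²Γ∞ = D²λ`, and two integrations by parts move `D²` onto `v ⊗ v`.
[cite: GilbargTrudinger2001, Lemma 4.2] -/
theorem laplacian_farPotential (h₀ : 0 < r₀) (h₁ : r₀ < r₁) {v : ℝ³ → ℝ³} (hv : ContDiff ℝ 2 v)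
    (hL2 : Integrable fun y => ‖v y‖ ^ 2) (x : ℝ³) :
    Δ (farPotential r₀ r₁ v) x = ∫ z, newtonFarLaplacian r₀ r₁ z * pressureSource v (x - z) := by
  set b := stdOrthonormalBasis ℝ ℝ³
  obtain ⟨hQ, hQ2⟩ := contDiff_farPotential h₀ h₁ hv.continuous hL2
  rw [FluidPDE.laplacian_eq_sum_fderiv_fderiv b hQ x]
  simp_rw [hQ2]
  -- integrability of each summand
  obtain ⟨M₀, M₁, M₂, -, -, hM₂⟩ := exists_bounds_fderiv2_newtonFar h₀ h₁
  set D4 := fderiv ℝ (fderiv ℝ (fderiv ℝ (fderiv ℝ (newtonFar r₀ r₁)))) with hD4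
  have hD4c : Continuous D4 :=
    ((contDiff_fderiv2_newtonFar h₀ h₁).fderiv_right (m := 1) le_rfl).continuous_fderiv
      one_ne_zero
  have hint : ∀ i, Integrable fun y => D4 (x - y) (b i) (b i) (v y) (v y) := fun i => by
    have hΦc : Continuous fun z => D4 z (b i) (b i) :=
      (hD4c.clm_apply continuous_const).clm_apply continuous_const
    have hΦb : ∀ z, ‖D4 z (b i) (b i)‖ ≤ M₂ * ‖b i‖ * ‖b i‖ := fun z =>
      calc ‖D4 z (b i) (b i)‖ ≤ ‖D4 z (b i)‖ * ‖b i‖ := ContinuousLinearMap.le_opNorm _ _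
        _ ≤ ‖D4 z‖ * ‖b i‖ * ‖b i‖ := by gcongr; exact ContinuousLinearMap.le_opNorm _ _
        _ ≤ M₂ * ‖b i‖ * ‖b i‖ := by gcongr; exact hM₂ z
    exact integrable_clm_apply_comp_sub (L := fun y => evalDiag (v y)) hΦc hΦb
      (continuous_evalDiag.comp hv.continuous) (integrable_evalDiag_comp hv.continuous hL2) x
  rw [← integral_finsetSum _ fun i _ => hint i]
  have key : ∀ y, ∑ i, D4 (x - y) (b i) (b i) (v y) (v y) =
      fderiv ℝ (fderiv ℝ (newtonFarLaplacian r₀ r₁)) (x - y) (v y) (v y) := fun y =>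
    sum_fderiv4_newtonFar_apply h₀ h₁ b (x - y) (v y)
  rw [integral_congr_ae (Eventually.of_forall key)]
  -- double integration by parts with the test function `λ`
  have hlam : ContDiff ℝ 2 (newtonFarLaplacian r₀ r₁) := contDiff_newtonFarLaplacian h₀ h₁
  rw [← integral_comp_sub_mul_pressureSource hlam (hasCompactSupport_newtonFarLaplacian h₀.le h₁)
    hv x, ← integral_sub_left_eq_self
    (fun z => newtonFarLaplacian r₀ r₁ z * pressureSource v (x - z)) volume x]
  simp only [sub_sub_cancel]

/-! #### The pressure potential: regularity and the Poisson equation -/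

/-- **`Q[v] ∈ C²`** for `v ∈ C⁴` with `|v|² ∈ L¹`. [cite: GilbargTrudinger2001, Lemma 4.2] -/
theorem contDiff_pressurePotential {v : ℝ³ → ℝ³} (hv : ContDiff ℝ 4 v)
    (hL2 : Integrable fun y => ‖v y‖ ^ 2) : ContDiff ℝ 2 (pressurePotential v) := by
  have h1 : ContDiff ℝ 2 (nearPotential 1 2 v) :=
    contDiff_nearPotential zero_le_one one_lt_two 2 (by exact_mod_cast hv)
  have h2 : ContDiff ℝ 2 (farPotential 1 2 v) :=
    (contDiff_farPotential one_pos one_lt_two hv.continuous hL2).1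
  exact h1.neg.sub h2

/-- **The Poisson equation `ΔQ[v] = -G[v] = -∂ᵢ∂ⱼ(vᵢvⱼ)`** for `v ∈ C⁴` with `|v|² ∈ L¹`
(Gilbarg–Trudinger Lemma 4.2 / (2.17), assembled from `laplacian_nearPotential` and
`laplacian_farPotential`: the `λ * G` terms cancel). [cite: GilbargTrudinger2001, Lemma 4.2] -/
theorem laplacian_pressurePotential {v : ℝ³ → ℝ³} (hv : ContDiff ℝ 4 v)
    (hL2 : Integrable fun y => ‖v y‖ ^ 2) (x : ℝ³) :
    Δ (pressurePotential v) x = -pressureSource v x := by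
  have h1 : ContDiff ℝ 2 (nearPotential 1 2 v) :=
    contDiff_nearPotential zero_le_one one_lt_two 2 (by exact_mod_cast hv)
  have h2 : ContDiff ℝ 2 (farPotential 1 2 v) :=
    (contDiff_farPotential one_pos one_lt_two hv.continuous hL2).1
  have e : pressurePotential v = -(nearPotential 1 2 v + farPotential 1 2 v) := by
    funext y
    simp only [pressurePotential, Pi.neg_apply, Pi.add_apply]
    ring
  rw [e, laplacian_neg, Pi.neg_apply, (h1.contDiffAt).laplacian_add h2.contDiffAt,
    laplacian_nearPotential one_pos one_lt_two hv,
    laplacian_farPotential one_pos one_lt_two (hv.of_le (by norm_num)) hL2]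
  ring

/-! #### Independence of the cutoff scale -/

/-- Second derivatives of a difference of `C²` functions. [folklore] -/
theorem fderiv2_sub {f g : ℝ³ → ℝ} (hf : ContDiff ℝ 2 f) (hg : ContDiff ℝ 2 g) (z : ℝ³) :
    fderiv ℝ (fderiv ℝ (fun w => f w - g w)) z =
      fderiv ℝ (fderiv ℝ f) z - fderiv ℝ (fderiv ℝ g) z := by
  have hfd : Differentiable ℝ f := hf.differentiable two_ne_zero
  have hgd : Differentiable ℝ g := hg.differentiable two_ne_zero
  have h1 : fderiv ℝ (fun w => f w - g w) = fun w => fderiv ℝ f w - fderiv ℝ g w :=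
    funext fun w => fderiv_fun_sub (hfd w) (hgd w)
  rw [h1]
  exact fderiv_fun_sub ((hf.fderiv_right (m := 1) le_rfl).differentiable one_ne_zero z)
    ((hg.fderiv_right (m := 1) le_rfl).differentiable one_ne_zero z)

/-- `Γ₀^{R,2R} - Γ₀^{1,2} = Γ∞^{1,2} - Γ∞^{R,2R}`. [folklore] -/
theorem newtonNear_sub_newtonNear (R : ℝ) (z : ℝ³) :
    newtonNear (R * 1) (R * 2) z - newtonNear 1 2 z = newtonFar 1 2 z - newtonFar (R * 1) (R * 2) z := by
  have h1 := newtonNear_add_newtonFar (R * 1) (R * 2) z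
  have h2 := newtonNear_add_newtonFar 1 2 z
  linarith

/-- Integrability of the far-potential integrand. [folklore] -/
theorem integrable_farPotential_integrand (h₀ : 0 < r₀) (h₁ : r₀ < r₁) {v : ℝ³ → ℝ³}
    (hv : Continuous v) (hL2 : Integrable fun y => ‖v y‖ ^ 2) (x : ℝ³) :
    Integrable fun y => fderiv ℝ (fderiv ℝ (newtonFar r₀ r₁)) (x - y) (v y) (v y) := by
  obtain ⟨M₀, -, -, hM₀, -, -⟩ := exists_bounds_fderiv2_newtonFar h₀ h₁
  exact integrable_clm_apply_comp_sub (L := fun y => evalDiag (v y))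
    (contDiff_fderiv2_newtonFar h₀ h₁).continuous hM₀ (continuous_evalDiag.comp hv)
    (integrable_evalDiag_comp hv hL2) x

/-- Integrability of the near-potential integrand. [folklore] -/
theorem integrable_nearPotential_integrand (h₀ : 0 ≤ r₀) (h₁ : r₀ < r₁) {v : ℝ³ → ℝ³}
    (hv : ContDiff ℝ 2 v) (x : ℝ³) :
    Integrable fun z => newtonNear r₀ r₁ z * pressureSource v (x - z) :=
  integrable_smul_comp_sub (integrable_newtonNear h₀ h₁)
    (fun z hz => newtonNear_eq_zero h₀ h₁ hz.le)
    (contDiff_pressureSource (n := 0) (by exact_mod_cast hv)).continuous x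

/-- **Independence of the cutoff scale**: `Q[v] = -Q₁^{R,2R}[v] - Q₂^{R,2R}[v]` for every
`R > 0` (the difference of the near kernels is the smooth compactly supported
`Γ∞^{1,2} - Γ∞^{R,2R}`, on which the two integrations by parts are exact). [folklore] -/
theorem pressurePotential_eq_scale {R : ℝ} (hR : 0 < R) {v : ℝ³ → ℝ³} (hv : ContDiff ℝ 2 v)
    (hL2 : Integrable fun y => ‖v y‖ ^ 2) (x : ℝ³) :
    pressurePotential v x = -nearPotential (R * 1) (R * 2) v x - farPotential (R * 1) (R * 2) v x := by
  have hR1 : 0 < R * 1 := by linarith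
  have hR2 : R * 1 < R * 2 := by linarith
  set Ψ : ℝ³ → ℝ := fun z => newtonFar 1 2 z - newtonFar (R * 1) (R * 2) z with hΨ
  have hΨs : ContDiff ℝ 2 Ψ := (contDiff_newtonFar one_pos one_lt_two).sub
    (contDiff_newtonFar hR1 hR2)
  have hΨc : HasCompactSupport Ψ := by
    refine HasCompactSupport.intro (isCompact_closedBall (0 : ℝ³) (max 2 (R * 2))) fun z hz => ?_
    rw [mem_closedBall_zero_iff, not_le, max_lt_iff] at hz
    simp only [hΨ]
    rw [newtonFar_eq_newtonKernel zero_le_one one_lt_two hz.1.le,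
      newtonFar_eq_newtonKernel hR1.le hR2 hz.2.le, sub_self]
  -- the near potentials differ by `∫ Ψ(z) G(x - z) dz`
  have h1 : nearPotential (R * 1) (R * 2) v x - nearPotential 1 2 v x =
      ∫ z, Ψ z * pressureSource v (x - z) := by
    rw [nearPotential, nearPotential, ← integral_sub
      (integrable_nearPotential_integrand hR1.le hR2 hv x)
      (integrable_nearPotential_integrand zero_le_one one_lt_two hv x)]
    refine integral_congr_ae (Eventually.of_forall fun z => ?_)
    simp only [hΨ]
    rw [← sub_mul, newtonNear_sub_newtonNear]
  -- which by the double integration by parts is the difference of the far potentials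
  have h2 : ∫ z, Ψ z * pressureSource v (x - z) =
      farPotential 1 2 v x - farPotential (R * 1) (R * 2) v x := by
    rw [← integral_sub_left_eq_self (fun z => Ψ z * pressureSource v (x - z)) volume x]
    simp only [sub_sub_cancel]
    rw [integral_comp_sub_mul_pressureSource hΨs hΨc hv x, farPotential, farPotential,
      ← integral_sub (integrable_farPotential_integrand one_pos one_lt_two hv.continuous hL2 x)
        (integrable_farPotential_integrand hR1 hR2 hv.continuous hL2 x)]
    refine integral_congr_ae (Eventually.of_forall fun y => ?_)
    dsimp only
    rw [fderiv2_sub (contDiff_newtonFar one_pos one_lt_two) (contDiff_newtonFar hR1 hR2)]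
    rfl
  rw [pressurePotential]
  linarith [h1, h2]

end R3

/-! ### The principal-value representation -/

section PV

-- nested operator types `ℝ³ →L[ℝ] ℝ³ →L[ℝ] ℝ³ →L[ℝ] ℝ`
set_option maxSynthPendingDepth 3

/-- Local notation for physical space `ℝ³ = EuclideanSpace ℝ (Fin 3)`. -/
local notation "ℝ³" => EuclideanSpace ℝ (Fin 3)

variable {r₀ r₁ : ℝ}

/-- **`K = -D²Γ` on the diagonal**: `K(z)(a) = -D²Γ(z)(a, a)` for `z ≠ 0` (Tao 2011, (35)). [folklore] -/
theorem pressureKernel_eq_neg_fderiv2 {z : ℝ³} (hz : z ≠ 0) (a : ℝ³) :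
    pressureKernel z a = -fderiv ℝ (fderiv ℝ newtonKernel) z a a := by
  have hd : DifferentiableAt ℝ (fderiv ℝ newtonKernel) z :=
    ((contDiffAt_newtonKernel hz (n := 2)).fderiv_right (m := 1) le_rfl).differentiableAt
      one_ne_zero
  rw [← FluidPDE.fderiv_apply_const_apply hd, fderiv_fderiv_newtonKernel_apply_self hz, neg_neg]

/-- Off the origin, `D²Γ = D²Γ₀ + D²Γ∞`. [folklore] -/
theorem fderiv2_newtonKernel_eq_add (h₀ : 0 < r₀) (h₁ : r₀ < r₁) {z : ℝ³} (hz : z ≠ 0) :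
    fderiv ℝ (fderiv ℝ newtonKernel) z =
      fderiv ℝ (fderiv ℝ (newtonNear r₀ r₁)) z + fderiv ℝ (fderiv ℝ (newtonFar r₀ r₁)) z := by
  have hΓ : newtonKernel = fun w => newtonNear r₀ r₁ w + newtonFar r₀ r₁ w :=
    funext fun w => (newtonNear_add_newtonFar r₀ r₁ w).symm
  have hFar : ContDiff ℝ 2 (newtonFar r₀ r₁) := contDiff_newtonFar h₀ h₁
  have hFard : Differentiable ℝ (newtonFar r₀ r₁) := hFar.differentiable two_ne_zero
  have hDFard : Differentiable ℝ (fderiv ℝ (newtonFar r₀ r₁)) :=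
    (hFar.fderiv_right (m := 1) le_rfl).differentiable one_ne_zero
  -- on the open set `{0}ᶜ` the first derivatives add
  have h1 : fderiv ℝ newtonKernel =ᶠ[𝓝 z]
      fun w => fderiv ℝ (newtonNear r₀ r₁) w + fderiv ℝ (newtonFar r₀ r₁) w := by
    filter_upwards [isOpen_compl_singleton.mem_nhds hz] with w hw
    rw [hΓ]
    exact fderiv_fun_add ((contDiffAt_newtonNear r₀ r₁ hw (n := 1)).differentiableAt one_ne_zero)
      (hFard w)
  rw [h1.fderiv_eq]
  exact fderiv_fun_add (((contDiffAt_newtonNear r₀ r₁ hz (n := 2)).fderiv_right (m := 1)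
    le_rfl).differentiableAt one_ne_zero) (hDFard z)

/-- `D²Γ∞ = 0` on the open ball of radius `r₀`. [folklore] -/
theorem fderiv2_newtonFar_eq_zero (h₀ : 0 ≤ r₀) (h₁ : r₀ < r₁) {z : ℝ³} (hz : ‖z‖ < r₀) :
    fderiv ℝ (fderiv ℝ (newtonFar r₀ r₁)) z = 0 := by
  have e := ((newtonFar_eventuallyEq_zero h₀ h₁ hz).fderiv (𝕜 := ℝ)).fderiv (𝕜 := ℝ)
  rw [e.eq_of_nhds]
  simp

/-- Change of variables `y = x - z` on balls: `∫_{B̄(x,ε)} f(y) dy = ∫_{B̄(0,ε)} f(x - z) dz`. [folklore] -/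
theorem setIntegral_closedBall_eq_comp_sub {F : Type*} [NormedAddCommGroup F] [NormedSpace ℝ F]
    (f : ℝ³ → F) (x : ℝ³) (ε : ℝ) :
    ∫ y in closedBall x ε, f y = ∫ z in closedBall (0 : ℝ³) ε, f (x - z) := by
  rw [← integral_indicator measurableSet_closedBall, ← integral_indicator measurableSet_closedBall,
    ← integral_sub_left_eq_self ((closedBall x ε).indicator f) volume x]
  refine integral_congr_ae (Eventually.of_forall fun z => ?_)
  have hmem : x - z ∈ closedBall x ε ↔ z ∈ closedBall (0 : ℝ³) ε := by
    rw [mem_closedBall, mem_closedBall_zero_iff, dist_eq_norm, sub_sub_cancel_left, norm_neg]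
  show (closedBall x ε).indicator f (x - z) = (closedBall 0 ε).indicator (fun z => f (x - z)) z
  by_cases hz : z ∈ closedBall (0 : ℝ³) ε
  · rw [indicator_of_mem (hmem.2 hz), indicator_of_mem hz]
  · rw [indicator_of_notMem (fun h => hz (hmem.1 h)), indicator_of_notMem hz]

/-- **The regularised near kernel** `Φ_δ = Γ∞^{δ,2δ} - Γ∞^{1,2} = (1 - θ_{δ,2δ})Γ₀` (`2δ ≤ 1`):
smooth, supported in `|z| ≤ 2`, equal to `Γ₀` near every point with `|z| > 2δ`, with
`D²Φ_δ = D²Γ∞^{δ,2δ}` on `|z| < 1`, and dominated by `|Γ₀|`. [folklore] -/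
theorem regularisedNear_props {δ : ℝ} (hδ : 0 < δ) (hδ1 : δ * 2 ≤ 1) :
    ContDiff ℝ 2 (fun z : ℝ³ => newtonFar δ (δ * 2) z - newtonFar 1 2 z) ∧
    HasCompactSupport (fun z : ℝ³ => newtonFar δ (δ * 2) z - newtonFar 1 2 z) ∧
    (∀ z : ℝ³, δ * 2 < ‖z‖ → fderiv ℝ (fderiv ℝ fun z : ℝ³ => newtonFar δ (δ * 2) z - newtonFar 1 2 z) z
      = fderiv ℝ (fderiv ℝ (newtonNear 1 2)) z) ∧
    (∀ z : ℝ³, ‖z‖ < 1 → fderiv ℝ (fderiv ℝ fun z : ℝ³ => newtonFar δ (δ * 2) z - newtonFar 1 2 z) z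
      = fderiv ℝ (fderiv ℝ (newtonFar δ (δ * 2))) z) ∧
    (∀ z : ℝ³, |newtonFar δ (δ * 2) z - newtonFar 1 2 z| ≤ |newtonNear 1 2 z|) := by
  have hδ2 : δ < δ * 2 := by linarith
  have hF1 : ContDiff ℝ 2 (newtonFar δ (δ * 2)) := contDiff_newtonFar hδ hδ2
  have hF2 : ContDiff ℝ 2 (newtonFar (1 : ℝ) 2) := contDiff_newtonFar one_pos one_lt_two
  refine ⟨hF1.sub hF2, ?_, ?_, ?_, ?_⟩
  · refine HasCompactSupport.intro (isCompact_closedBall (0 : ℝ³) 2) fun z hz => ?_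
    rw [mem_closedBall_zero_iff, not_le] at hz
    rw [newtonFar_sub_newtonFar hδ hδ1 one_lt_two, newtonNear_eq_zero zero_le_one one_lt_two hz.le,
      mul_zero]
  · intro z hz
    have he : (fun z : ℝ³ => newtonFar δ (δ * 2) z - newtonFar 1 2 z) =ᶠ[𝓝 z] newtonNear 1 2 := by
      have : {w : ℝ³ | δ * 2 < ‖w‖} ∈ 𝓝 z :=
        (isOpen_lt continuous_const continuous_norm).mem_nhds hz
      filter_upwards [this] with w hw
      rw [newtonFar_sub_newtonFar hδ hδ1 one_lt_two, radialCutoff_eq_zero hδ.le hδ2 hw.le,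
        sub_zero, one_mul]
    exact ((he.fderiv (𝕜 := ℝ)).fderiv (𝕜 := ℝ)).eq_of_nhds
  · intro z hz
    rw [fderiv2_sub hF1 hF2, fderiv2_newtonFar_eq_zero zero_le_one one_lt_two hz, sub_zero]
  · intro z
    rw [newtonFar_sub_newtonFar hδ hδ1 one_lt_two, abs_mul]
    refine mul_le_of_le_one_left (abs_nonneg _) ?_
    rw [abs_le]
    constructor
    · linarith [radialCutoff_le_one δ (δ * 2) z]
    · linarith [radialCutoff_nonneg δ (δ * 2) z]

/-- **The principal value of the pressure kernel (Tao 2011, (35); Gilbarg–Trudinger (4.9)–(4.10)).**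
For `v ∈ C²(ℝ³; ℝ³)` with `|v|² ∈ L¹`, at every point `x` the truncated singular integrals
`∫_{|x-y|>ε} K(x-y)(v y) dy` converge as `ε → 0⁺` to `Q[v](x) + |v(x)|²/3`. Proof: on
`|x - y| > ε` write `K = -D²Γ₀ - D²Γ∞`; the `Γ∞` part is `-Q₂[v](x)` exactly (`ε < 1`); for the
`Γ₀` part use the regularisation `Φ_{ε/2} = Γ∞^{ε/2,ε} - Γ∞` (smooth, `= Γ₀` on `|z| > ε`), the
exact double integration by parts `∫ Φ G = ∫ D²Φ (v ⊗ v)`, and split the right side into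
`|x - y| > ε` (the truncated `Γ₀` integral) and `|x - y| ≤ ε`, where `D²Φ = D²Γ∞^{ε/2,ε}` has
integral `|v(x)|²/3` against the frozen tensor `v(x) ⊗ v(x)` (`NewtonPotential`, trace term) up to
an error `O(sup_{|z|≤ε}|v(x-z) - v(x)|)`; finally `∫ Φ_{ε/2} G → ∫ Γ₀ G = Q₁` by dominated
convergence. [cite: Tao2011, (35) and (42)] -/
theorem hasPressurePV_pressurePotential {v : ℝ³ → ℝ³} (hv : ContDiff ℝ 2 v)
    (hL2 : Integrable fun y => ‖v y‖ ^ 2) (x : ℝ³) :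
    HasPressurePV v x (pressurePotential v x + ‖v x‖ ^ 2 / 3) := by
  have hvc : Continuous v := hv.continuous
  set G := pressureSource v with hG_def
  have hGc : Continuous G := (contDiff_pressureSource (n := 0) (by exact_mod_cast hv)).continuous
  set Γ₀ := newtonNear (1 : ℝ) 2 with hΓ₀_def
  set Q₂ := farPotential 1 2 v x with hQ₂_def
  -- the regularised kernels and the auxiliary quantities
  set Φ : ℝ → ℝ³ → ℝ := fun ε z => newtonFar (ε / 2) (ε / 2 * 2) z - newtonFar 1 2 z with hΦ_def
  set A : ℝ → ℝ := fun ε => ∫ z, Φ ε z * G (x - z) with hA_def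
  set I : ℝ → ℝ := fun ε => ∫ z in closedBall (0 : ℝ³) ε,
    fderiv ℝ (fderiv ℝ (newtonFar (ε / 2) (ε / 2 * 2))) z (v (x - z)) (v (x - z)) with hI_def
  refine ⟨?_, ?_⟩
  · -- integrability of the truncated integrand, for every `ε > 0`
    filter_upwards [self_mem_nhdsWithin] with ε hε
    exact integrableOn_pressureKernel_compl_closedBall hvc hL2 x hε
  -- Step 1: the formula `T ε = -(A ε - I ε) - Q₂` for `0 < ε < 1`
  have hfar_int := integrable_farPotential_integrand one_pos one_lt_two hvc hL2 x
  have formula : ∀ ε, 0 < ε → ε < 1 →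
      truncatedPressureIntegral v x ε = -(A ε - I ε) - Q₂ := by
    intro ε hε hε1
    have hδ : 0 < ε / 2 := by linarith
    have hδ1 : ε / 2 * 2 ≤ 1 := by linarith
    have hεε : ε / 2 * 2 = ε := by ring
    obtain ⟨hΦs, hΦc, hΦfar, hΦnear, -⟩ := regularisedNear_props hδ hδ1
    set S := (closedBall x ε)ᶜ with hS_def
    have hS : MeasurableSet S := measurableSet_closedBall.compl
    have hmemS : ∀ y, y ∈ S ↔ ε < ‖x - y‖ := fun y => by
      rw [hS_def, mem_compl_iff, mem_closedBall, not_le, dist_eq_norm, ← norm_neg, neg_sub]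
    -- (a) pointwise on `S`: `K = -D²Γ₀ - D²Γ∞`
    have hK : ∀ y ∈ S, pressureKernel (x - y) (v y) =
        -fderiv ℝ (fderiv ℝ Γ₀) (x - y) (v y) (v y) -
          fderiv ℝ (fderiv ℝ (newtonFar 1 2)) (x - y) (v y) (v y) := by
      intro y hy
      have hz : x - y ≠ 0 := fun h => by
        have := (hmemS y).1 hy; rw [h, norm_zero] at this; linarith
      rw [pressureKernel_eq_neg_fderiv2 hz, fderiv2_newtonKernel_eq_add one_pos one_lt_two hz]
      simp only [_root_.add_apply]
      ring
    -- (b) the `Γ∞` part is `Q₂`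
    have hfar : ∫ y in S, fderiv ℝ (fderiv ℝ (newtonFar 1 2)) (x - y) (v y) (v y) = Q₂ := by
      rw [hQ₂_def, farPotential]
      refine setIntegral_eq_integral_of_forall_compl_eq_zero fun y hy => ?_
      have hy' : ‖x - y‖ < 1 := by
        have : ¬ ε < ‖x - y‖ := fun h => hy ((hmemS y).2 h)
        linarith [not_lt.1 this]
      rw [fderiv2_newtonFar_eq_zero zero_le_one one_lt_two hy']
      rfl
    -- (c) the `Γ₀` part via the regularisation
    obtain ⟨C, hC⟩ := ((hΦs.fderiv_right (m := 1) le_rfl).continuous_fderiv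
      one_ne_zero).bounded_above_of_compact_support ((hΦc.fderiv (𝕜 := ℝ)).fderiv (𝕜 := ℝ))
    have hΦint : Integrable fun y => fderiv ℝ (fderiv ℝ (Φ ε)) (x - y) (v y) (v y) :=
      integrable_clm_apply_comp_sub (L := fun y => evalDiag (v y))
        ((hΦs.fderiv_right (m := 1) le_rfl).continuous_fderiv one_ne_zero) hC
        (continuous_evalDiag.comp hvc) (integrable_evalDiag_comp hvc hL2) x
    have hibp : A ε = ∫ y, fderiv ℝ (fderiv ℝ (Φ ε)) (x - y) (v y) (v y) := by
      rw [hA_def]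
      dsimp only
      rw [← integral_sub_left_eq_self (fun z => Φ ε z * G (x - z)) volume x]
      simp only [sub_sub_cancel]
      exact integral_comp_sub_mul_pressureSource hΦs hΦc hv x
    have hsplit := integral_add_compl (μ := volume) (s := closedBall x ε)
      (f := fun y => fderiv ℝ (fderiv ℝ (Φ ε)) (x - y) (v y) (v y)) measurableSet_closedBall hΦint
    have hin : ∫ y in closedBall x ε, fderiv ℝ (fderiv ℝ (Φ ε)) (x - y) (v y) (v y) = I ε := by
      rw [hI_def]
      dsimp only
      rw [setIntegral_closedBall_eq_comp_sub]
      refine setIntegral_congr_fun measurableSet_closedBall fun z hz => ?_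
      rw [mem_closedBall_zero_iff] at hz
      have hz1 : ‖x - (x - z)‖ < 1 := by rw [sub_sub_cancel]; linarith
      simp only [sub_sub_cancel]
      rw [show fderiv ℝ (fderiv ℝ (Φ ε)) z = fderiv ℝ (fderiv ℝ (newtonFar (ε / 2) (ε / 2 * 2))) z
        from hΦnear z (by linarith)]
    have hout : ∫ y in S, fderiv ℝ (fderiv ℝ (Φ ε)) (x - y) (v y) (v y) =
        ∫ y in S, fderiv ℝ (fderiv ℝ Γ₀) (x - y) (v y) (v y) := by
      refine setIntegral_congr_fun hS fun y hy => ?_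
      show fderiv ℝ (fderiv ℝ (Φ ε)) (x - y) (v y) (v y) = _
      rw [show fderiv ℝ (fderiv ℝ (Φ ε)) (x - y) = fderiv ℝ (fderiv ℝ Γ₀) (x - y) from
        hΦfar (x - y) (by rw [hεε]; exact (hmemS y).1 hy)]
    have hnear : ∫ y in S, fderiv ℝ (fderiv ℝ Γ₀) (x - y) (v y) (v y) = A ε - I ε := by
      rw [hibp, ← hsplit, hin, hout]
      ring
    -- (d) integrability on `S` of the two parts and assembly
    have iFar : IntegrableOn (fun y => fderiv ℝ (fderiv ℝ (newtonFar 1 2)) (x - y) (v y) (v y)) S :=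
      hfar_int.integrableOn
    have iK : IntegrableOn (fun y => pressureKernel (x - y) (v y)) S :=
      integrableOn_pressureKernel_compl_closedBall hvc hL2 x hε
    have iNear : IntegrableOn (fun y => fderiv ℝ (fderiv ℝ Γ₀) (x - y) (v y) (v y)) S := by
      refine ((iK.neg).sub iFar).congr_fun (fun y hy => ?_) hS
      simp only [Pi.neg_apply, Pi.sub_apply]
      rw [hK y hy]
      ring
    rw [truncatedPressureIntegral, setIntegral_congr_fun hS hK]
    have : (fun y => -fderiv ℝ (fderiv ℝ Γ₀) (x - y) (v y) (v y) -
        fderiv ℝ (fderiv ℝ (newtonFar 1 2)) (x - y) (v y) (v y)) =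
        fun y => -(fderiv ℝ (fderiv ℝ Γ₀) (x - y) (v y) (v y) +
          fderiv ℝ (fderiv ℝ (newtonFar 1 2)) (x - y) (v y) (v y)) := by
      funext y; ring
    rw [this, integral_neg, integral_add iNear iFar, hnear, hfar]
    ring
  -- Step 2: `A ε → Q₁ = ∫ Γ₀(z) G(x - z) dz` (dominated convergence)
  have limA : Tendsto A (𝓝[>] 0) (𝓝 (nearPotential 1 2 v x)) := by
    obtain ⟨C, hC0, hC⟩ := exists_bound_comp_sub hGc x 2
    have hC' : ∀ z ∈ closedBall (0 : ℝ³) 2, ‖G (x - z)‖ ≤ C := fun z hz =>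
      hC x (mem_closedBall_self zero_le_one) z hz
    rw [nearPotential]
    refine tendsto_integral_filter_of_dominated_convergence (fun z => ‖Γ₀ z‖ * C) ?_ ?_ ?_ ?_
    · filter_upwards [Ioo_mem_nhdsGT one_pos] with ε hε
      have hδ : 0 < ε / 2 := by linarith [hε.1]
      have hδ2 : ε / 2 < ε / 2 * 2 := by linarith [hε.1]
      exact (((contDiff_newtonFar hδ hδ2 (n := 0)).continuous.sub
        (contDiff_newtonFar one_pos one_lt_two (n := 0)).continuous).mul
        (hGc.comp (continuous_const.sub continuous_id))).aestronglyMeasurable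
    · filter_upwards [Ioo_mem_nhdsGT one_pos] with ε hε
      have hδ : 0 < ε / 2 := by linarith [hε.1]
      have hδ1 : ε / 2 * 2 ≤ 1 := by linarith [hε.2]
      obtain ⟨-, -, -, -, hdom⟩ := regularisedNear_props hδ hδ1
      refine Eventually.of_forall fun z => ?_
      rw [norm_mul]
      by_cases hz : ‖z‖ ≤ 2
      · refine mul_le_mul ?_ (hC' z (mem_closedBall_zero_iff.2 hz)) (norm_nonneg _)
          (norm_nonneg _)
        rw [Real.norm_eq_abs, Real.norm_eq_abs]
        exact hdom z
      · have h0 : newtonNear 1 2 z = 0 := newtonNear_eq_zero zero_le_one one_lt_two (not_le.1 hz).le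
        have h1 : Φ ε z = 0 := by
          have := hdom z
          rw [h0, abs_zero] at this
          exact abs_nonpos_iff.1 this
        rw [h1, norm_zero, zero_mul]
        positivity
    · exact (integrable_newtonNear zero_le_one one_lt_two).norm.mul_const C
    · refine Eventually.of_forall fun z => ?_
      refine (tendsto_const_nhds (x := Γ₀ z * G (x - z))).congr' ?_
      by_cases hz : z = 0
      · filter_upwards [Ioo_mem_nhdsGT one_pos] with ε hε
        have hδ : 0 < ε / 2 := by linarith [hε.1]
        have hδ1 : ε / 2 * 2 ≤ 1 := by linarith [hε.2]
        have hΓ0 : Γ₀ 0 = 0 := by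
          rw [hΓ₀_def, newtonNear, newtonKernel_eq, norm_zero, mul_zero, inv_zero, neg_zero, mul_zero]
        simp only [hz, hΦ_def]
        rw [newtonFar_sub_newtonFar hδ hδ1 one_lt_two, ← hΓ₀_def, hΓ0, mul_zero]
      · have hzn : 0 < ‖z‖ := norm_pos_iff.2 hz
        filter_upwards [Ioo_mem_nhdsGT (show (0 : ℝ) < min 1 ‖z‖ from lt_min one_pos hzn)]
          with ε hε
        have hε1 : ε < 1 := hε.2.trans_le (min_le_left _ _)
        have hεz : ε < ‖z‖ := hε.2.trans_le (min_le_right _ _)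
        have hδ : 0 < ε / 2 := by linarith [hε.1]
        have hδ1 : ε / 2 * 2 ≤ 1 := by linarith
        have hδ2 : ε / 2 < ε / 2 * 2 := by linarith [hε.1]
        simp only [hΦ_def]
        rw [newtonFar_sub_newtonFar hδ hδ1 one_lt_two,
          radialCutoff_eq_zero hδ.le hδ2 (show ε / 2 * 2 ≤ ‖z‖ by linarith), sub_zero, one_mul]
  -- Step 3: `I ε → |v x|²/3` (trace term + continuity of `v` at `x`)
  have limI : Tendsto I (𝓝[>] 0) (𝓝 (‖v x‖ ^ 2 / 3)) := by
    obtain ⟨M₂, -, -, hM₂, -, -⟩ := exists_bounds_fderiv2_newtonFar (r₀ := (1 : ℝ)) (r₁ := 2)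
      one_pos one_lt_two
    have hM₂0 : 0 ≤ M₂ := (norm_nonneg _).trans (hM₂ 0)
    set V₁ : ℝ := (volume : Measure ℝ³).real (closedBall (0 : ℝ³) 1) with hV₁
    have hV₁0 : 0 ≤ V₁ := measureReal_nonneg
    refine Metric.tendsto_nhds.2 fun η hη => ?_
    -- continuity of `v` at `x`
    set K₀ : ℝ := 8 * M₂ * V₁ * (2 * ‖v x‖ + 1) + 1 with hK₀
    have hK₀pos : 0 < K₀ := by positivity
    set η' : ℝ := min 1 (η / 2 / K₀) with hη'
    have hη'pos : 0 < η' := lt_min one_pos (by positivity)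
    have hη'1 : η' ≤ 1 := min_le_left _ _
    obtain ⟨ρ, hρ, hρv⟩ := Metric.continuousAt_iff.1 (hvc.continuousAt (x := x)) η' hη'pos
    filter_upwards [Ioo_mem_nhdsGT (lt_min one_pos hρ)] with ε hε
    have hε0 : 0 < ε := hε.1
    have hε1 : ε < 1 := hε.2.trans_le (min_le_left _ _)
    have hερ : ε < ρ := hε.2.trans_le (min_le_right _ _)
    have hδ : 0 < ε / 2 := by linarith
    have hδ2 : ε / 2 < ε / 2 * 2 := by linarith
    have hεε : ε / 2 * 2 = ε := by ring
    -- the frozen-tensor integral is the trace term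
    have hJ : ∫ z in closedBall (0 : ℝ³) ε,
        fderiv ℝ (fderiv ℝ (newtonFar (ε / 2) (ε / 2 * 2))) z (v x) (v x) = ‖v x‖ ^ 2 / 3 := by
      have := setIntegral_fderiv2_newtonFar_apply_self hδ hδ2 (v x)
      rw [show closedBall (0 : ℝ³) ε = closedBall 0 (ε / 2 * 2) by rw [hεε]]
      exact this
    -- the kernel bound `‖D²Γ∞^{ε/2,ε}‖ ≤ 8 ε⁻³ M₂`
    have hker : ∀ z, ‖fderiv ℝ (fderiv ℝ (newtonFar (ε / 2) (ε / 2 * 2))) z‖ ≤ (ε / 2)⁻¹ ^ 3 * M₂ := by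
      intro z
      have := norm_fderiv2_newtonFar_scale_le (r₀ := (1 : ℝ)) (r₁ := 2) hδ hM₂ z
      rwa [mul_one] at this
    -- pointwise bound of the error integrand on the small ball
    have hpt : ∀ z ∈ closedBall (0 : ℝ³) ε,
        ‖fderiv ℝ (fderiv ℝ (newtonFar (ε / 2) (ε / 2 * 2))) z (v (x - z)) (v (x - z)) -
          fderiv ℝ (fderiv ℝ (newtonFar (ε / 2) (ε / 2 * 2))) z (v x) (v x)‖ ≤
          (ε / 2)⁻¹ ^ 3 * M₂ * ((2 * ‖v x‖ + 1) * η') := by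
      intro z hz
      rw [mem_closedBall_zero_iff] at hz
      set B := fderiv ℝ (fderiv ℝ (newtonFar (ε / 2) (ε / 2 * 2))) z with hB
      have hd : ‖v (x - z) - v x‖ ≤ η' := by
        refine (le_of_lt (hρv ?_))
        rw [dist_eq_norm, sub_sub_cancel_left, norm_neg]
        linarith
      have hw : ‖v (x - z)‖ ≤ ‖v x‖ + η' := by
        calc ‖v (x - z)‖ = ‖v x + (v (x - z) - v x)‖ := by abel_nf
          _ ≤ ‖v x‖ + ‖v (x - z) - v x‖ := norm_add_le _ _
          _ ≤ ‖v x‖ + η' := by linarith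
      have e : B (v (x - z)) (v (x - z)) - B (v x) (v x) =
          B (v (x - z)) (v (x - z) - v x) + B (v (x - z) - v x) (v x) := by
        simp only [map_sub, _root_.sub_apply]
        ring
      rw [e]
      calc ‖B (v (x - z)) (v (x - z) - v x) + B (v (x - z) - v x) (v x)‖
          ≤ ‖B (v (x - z)) (v (x - z) - v x)‖ + ‖B (v (x - z) - v x) (v x)‖ := norm_add_le _ _
        _ ≤ ‖B‖ * ‖v (x - z)‖ * ‖v (x - z) - v x‖ + ‖B‖ * ‖v (x - z) - v x‖ * ‖v x‖ := by
            gcongr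
            · exact (B.le_opNorm₂ _ _)
            · exact (B.le_opNorm₂ _ _)
        _ ≤ ((ε / 2)⁻¹ ^ 3 * M₂) * (‖v x‖ + η') * η' + ((ε / 2)⁻¹ ^ 3 * M₂) * η' * ‖v x‖ := by
            gcongr
            · exact hker z
            · exact hker z
        _ = (ε / 2)⁻¹ ^ 3 * M₂ * ((2 * ‖v x‖ + η') * η') := by ring
        _ ≤ (ε / 2)⁻¹ ^ 3 * M₂ * ((2 * ‖v x‖ + 1) * η') := by gcongr
    -- integrability of the two integrands on the ball
    have hcont : Continuous fun z => fderiv ℝ (fderiv ℝ (newtonFar (ε / 2) (ε / 2 * 2))) z :=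
      (contDiff_fderiv2_newtonFar hδ hδ2).continuous
    have i1 : IntegrableOn (fun z => fderiv ℝ (fderiv ℝ (newtonFar (ε / 2) (ε / 2 * 2))) z
        (v (x - z)) (v (x - z))) (closedBall (0 : ℝ³) ε) :=
      ((hcont.clm_apply (hvc.comp (continuous_const.sub continuous_id))).clm_apply
        (hvc.comp (continuous_const.sub continuous_id))).continuousOn.integrableOn_compact
        (isCompact_closedBall _ _)
    have i2 : IntegrableOn (fun z => fderiv ℝ (fderiv ℝ (newtonFar (ε / 2) (ε / 2 * 2))) z
        (v x) (v x)) (closedBall (0 : ℝ³) ε) :=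
      ((hcont.clm_apply continuous_const).clm_apply continuous_const).continuousOn.integrableOn_compact
        (isCompact_closedBall _ _)
    -- the estimate
    have hvol : (volume : Measure ℝ³).real (closedBall (0 : ℝ³) ε) = ε ^ 3 * V₁ := by
      rw [hV₁, Measure.addHaar_real_closedBall' volume (0 : ℝ³) hε0.le, finrank_euclideanSpace_fin]
    rw [Real.dist_eq]
    have hdiff : I ε - ‖v x‖ ^ 2 / 3 = ∫ z in closedBall (0 : ℝ³) ε,
        (fderiv ℝ (fderiv ℝ (newtonFar (ε / 2) (ε / 2 * 2))) z (v (x - z)) (v (x - z)) -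
          fderiv ℝ (fderiv ℝ (newtonFar (ε / 2) (ε / 2 * 2))) z (v x) (v x)) := by
      rw [integral_sub i1 i2, hJ]
    rw [hdiff]
    calc |∫ z in closedBall (0 : ℝ³) ε,
          (fderiv ℝ (fderiv ℝ (newtonFar (ε / 2) (ε / 2 * 2))) z (v (x - z)) (v (x - z)) -
            fderiv ℝ (fderiv ℝ (newtonFar (ε / 2) (ε / 2 * 2))) z (v x) (v x))|
        ≤ (ε / 2)⁻¹ ^ 3 * M₂ * ((2 * ‖v x‖ + 1) * η') *
            (volume : Measure ℝ³).real (closedBall (0 : ℝ³) ε) := by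
          rw [← Real.norm_eq_abs]
          exact norm_setIntegral_le_of_norm_le_const measure_closedBall_lt_top hpt
      _ = 8 * M₂ * V₁ * (2 * ‖v x‖ + 1) * η' := by
          rw [hvol]
          field_simp
          ring
      _ ≤ 8 * M₂ * V₁ * (2 * ‖v x‖ + 1) * (η / 2 / K₀) := by
          gcongr
          exact min_le_right _ _
      _ < η := by
          have h1 : 8 * M₂ * V₁ * (2 * ‖v x‖ + 1) < K₀ := by rw [hK₀]; linarith
          have h2 : 8 * M₂ * V₁ * (2 * ‖v x‖ + 1) * (η / 2 / K₀) ≤ K₀ * (η / 2 / K₀) := by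
            gcongr
          have h3 : K₀ * (η / 2 / K₀) = η / 2 := by field_simp
          linarith
  -- Step 4: conclusion
  have lim : Tendsto (fun ε => -(A ε - I ε) - Q₂) (𝓝[>] 0)
      (𝓝 (-(nearPotential 1 2 v x - ‖v x‖ ^ 2 / 3) - Q₂)) :=
    ((limA.sub limI).neg).sub tendsto_const_nhds
  have hval : -(nearPotential 1 2 v x - ‖v x‖ ^ 2 / 3) - Q₂ =
      pressurePotential v x + ‖v x‖ ^ 2 / 3 := by
    rw [pressurePotential, hQ₂_def]; ring
  rw [← hval]
  refine lim.congr' ?_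
  filter_upwards [Ioo_mem_nhdsGT one_pos] with ε hε
  exact (formula ε hε.1 hε.2).symm

/-- **The normalised pressure is the pressure potential**: for `v ∈ C²` with `|v|² ∈ L¹`,
`normalisedPressure v x = -|v(x)|²/3 + p.v.∫ K(x-y)(v y) dy = Q[v](x)` at every point
(Tao 2011, (35)). [cite: Tao2011, (35) and (42)] -/
theorem normalisedPressure_eq_pressurePotential {v : ℝ³ → ℝ³} (hv : ContDiff ℝ 2 v)
    (hL2 : Integrable fun y => ‖v y‖ ^ 2) (x : ℝ³) :
    normalisedPressure v x = pressurePotential v x := by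
  rw [normalisedPressure_eq (hasPressurePV_pressurePotential hv hL2 x), finrank_euclideanSpace_fin]
  push_cast
  ring

/-- Function form of `normalisedPressure_eq_pressurePotential`. [cite: Tao2011, (35) and (42)] -/
theorem normalisedPressure_eq_pressurePotential' {v : ℝ³ → ℝ³} (hv : ContDiff ℝ 2 v)
    (hL2 : Integrable fun y => ‖v y‖ ^ 2) : normalisedPressure v = pressurePotential v :=
  funext (normalisedPressure_eq_pressurePotential hv hL2)

end PV

/-! ### The duality/dilation bound -/

section Duality

-- nested operator types `ℝ³ →L[ℝ] ℝ³ →L[ℝ] ℝ³ →L[ℝ] ℝ`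
set_option maxSynthPendingDepth 3

/-- Local notation for physical space `ℝ³ = EuclideanSpace ℝ (Fin 3)`. -/
local notation "ℝ³" => EuclideanSpace ℝ (Fin 3)

/-- Second derivatives of a dilated translate:
`D²(ψ(R⁻¹(· - x₀)))(x) = R⁻² D²ψ(R⁻¹(x - x₀))`. [folklore] -/
theorem fderiv2_comp_inv_smul_sub {F : Type*} [NormedAddCommGroup F] [NormedSpace ℝ F]
    (ψ : ℝ³ → F) {R : ℝ} (hR : 0 < R) (x₀ x : ℝ³) :
    fderiv ℝ (fderiv ℝ (fun x => ψ (R⁻¹ • (x - x₀)))) x =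
      (R⁻¹ ^ 2) • fderiv ℝ (fderiv ℝ ψ) (R⁻¹ • (x - x₀)) := by
  set g : ℝ³ → F := fun w => (1 : ℝ) • ψ (R⁻¹ • w) with hg
  have h1 : (fun x => ψ (R⁻¹ • (x - x₀))) = fun x => g (x + -x₀) := by
    funext x; simp [hg, sub_eq_add_neg]
  have h2 : fderiv ℝ (fun x => g (x + -x₀)) = fun x => fderiv ℝ g (x + -x₀) :=
    funext fun x => fderiv_comp_add_right (-x₀)
  rw [h1, h2, fderiv_comp_add_right, hg, fderiv2_const_smul_comp_smul ψ 1 (inv_ne_zero hR.ne'),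
    one_mul, ← sub_eq_add_neg]

/-- A dilated translate of a compactly supported function has compact support. [folklore] -/
theorem hasCompactSupport_comp_inv_smul_sub {F : Type*} [NormedAddCommGroup F] {ψ : ℝ³ → F}
    (hψc : HasCompactSupport ψ) {R : ℝ} (hR : 0 < R) (x₀ : ℝ³) :
    HasCompactSupport fun x => ψ (R⁻¹ • (x - x₀)) := by
  refine HasCompactSupport.intro ((hψc.isCompact).image
    (show Continuous fun w : ℝ³ => x₀ + R • w by fun_prop)) fun x hx => ?_
  apply image_eq_zero_of_notMem_tsupport
  intro h
  exact hx ⟨R⁻¹ • (x - x₀), h, by simp [smul_smul, mul_inv_cancel₀ hR.ne']⟩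

/-- `∫ |ψ(R⁻¹(x - x₀))| dx = R³ ∫ |ψ|`. [folklore] -/
theorem integral_abs_comp_inv_smul_sub (ψ : ℝ³ → ℝ) {R : ℝ} (hR : 0 < R) (x₀ : ℝ³) :
    ∫ x, |ψ (R⁻¹ • (x - x₀))| = R ^ 3 * ∫ w, |ψ w| := by
  have h := Measure.integral_comp_inv_smul_of_nonneg volume (fun w : ℝ³ => |ψ w|) hR.le
  simp only [finrank_euclideanSpace_fin, smul_eq_mul] at h
  rw [← h, ← integral_sub_right_eq_self (fun x => |ψ (R⁻¹ • x)|) x₀]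

/-- **Duality and dilation bound (Tao 2011, §4, proof of Lemma 4.1 (i)).** For every test
function `ψ ∈ C²_c(ℝ³)` there is a constant `M` such that for every `v ∈ C²` with `|v|² ∈ L¹`,
every centre `x₀` and every scale `R > 0`,
`|∫ Q[v](x) ψ(R⁻¹(x - x₀)) dx| ≤ M ∫ |v|²`.
Proof: at cutoff scale `R` (`pressurePotential_eq_scale`), `∫ ψ_R Q₂^R` is bounded by
`‖ψ_R‖₁ ‖D²Γ∞^R‖_∞ ‖v‖₂² = (R³‖ψ‖₁)(R⁻³‖D²Γ∞‖_∞)‖v‖₂²`, and by Fubini and two integrations by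
parts `∫ ψ_R Q₁^R = ∫ Γ₀^R(z) ∫ D²ψ_R(w + z)(v w, v w) dw dz` is bounded by
`‖Γ₀^R‖₁ ‖D²ψ_R‖_∞ ‖v‖₂² = (R²‖Γ₀‖₁)(R⁻²‖D²ψ‖_∞)‖v‖₂²` ("by an integration by parts … from
the finite energy nature … this expression goes to zero as `R → ∞`", in scale-free form).
[cite: Tao2011, §4, proof of Lemma 4.1 (i)] -/
theorem abs_integral_pressurePotential_mul_le {ψ : ℝ³ → ℝ} (hψ : ContDiff ℝ 2 ψ)
    (hψc : HasCompactSupport ψ) :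
    ∃ M : ℝ, ∀ (v : ℝ³ → ℝ³), ContDiff ℝ 2 v → Integrable (fun y => ‖v y‖ ^ 2) →
      ∀ (x₀ : ℝ³) (R : ℝ), 0 < R →
        |∫ x, pressurePotential v x * ψ (R⁻¹ • (x - x₀))| ≤ M * ∫ y, ‖v y‖ ^ 2 := by
  -- the constants
  obtain ⟨m₂, -, -, hm₂, -, -⟩ := exists_bounds_fderiv2_newtonFar (r₀ := (1 : ℝ)) (r₁ := 2)
    one_pos one_lt_two
  have hm₂0 : 0 ≤ m₂ := (norm_nonneg _).trans (hm₂ 0)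
  obtain ⟨D₂, hD₂⟩ := ((hψ.fderiv_right (m := 1) le_rfl).continuous_fderiv
    one_ne_zero).bounded_above_of_compact_support ((hψc.fderiv (𝕜 := ℝ)).fderiv (𝕜 := ℝ))
  have hD₂0 : 0 ≤ D₂ := (norm_nonneg _).trans (hD₂ 0)
  set N₁ : ℝ := ∫ w, |newtonNear (1 : ℝ) 2 w| with hN₁
  have hN₁0 : 0 ≤ N₁ := integral_nonneg fun w => abs_nonneg _
  set Pψ : ℝ := ∫ w, |ψ w| with hPψ
  have hPψ0 : 0 ≤ Pψ := integral_nonneg fun w => abs_nonneg _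
  refine ⟨m₂ * Pψ + N₁ * D₂, fun v hv hL2 x₀ R hR => ?_⟩
  have hvc : Continuous v := hv.continuous
  set E := ∫ y, ‖v y‖ ^ 2 with hE
  have hE0 : 0 ≤ E := integral_nonneg fun y => by positivity
  have hR1 : 0 < R * 1 := by linarith
  have hR2 : R * 1 < R * 2 := by linarith
  -- the dilated test function
  set ψR : ℝ³ → ℝ := fun x => ψ (R⁻¹ • (x - x₀)) with hψR
  have hψRs : ContDiff ℝ 2 ψR := hψ.comp ((contDiff_id.sub contDiff_const).const_smul _)
  have hψRc : HasCompactSupport ψR := hasCompactSupport_comp_inv_smul_sub hψc hR x₀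
  have hψRcont : Continuous ψR := hψRs.continuous
  have hD2ψR : ∀ x, ‖fderiv ℝ (fderiv ℝ ψR) x‖ ≤ R⁻¹ ^ 2 * D₂ := fun x => by
    rw [hψR, fderiv2_comp_inv_smul_sub ψ hR, norm_smul, norm_pow, norm_inv, Real.norm_eq_abs,
      abs_of_pos hR]
    exact mul_le_mul_of_nonneg_left (hD₂ _) (by positivity)
  have hψR1 : ∫ x, |ψR x| = R ^ 3 * Pψ := integral_abs_comp_inv_smul_sub ψ hR x₀
  -- the source and the potentials at scale `R`
  set G := pressureSource v with hG
  have hGc : Continuous G := (contDiff_pressureSource (n := 0) (by exact_mod_cast hv)).continuous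
  set Q₁ := nearPotential (R * 1) (R * 2) v with hQ₁
  set Q₂ := farPotential (R * 1) (R * 2) v with hQ₂
  have hQ₁c : Continuous Q₁ :=
    (contDiff_nearPotential hR1.le hR2 0 (by exact_mod_cast hv)).continuous
  have hQ₂c : Continuous Q₂ := (contDiff_farPotential hR1 hR2 hvc hL2).1.continuous
  have hQ : (fun x => pressurePotential v x * ψR x) = fun x => -(Q₁ x * ψR x) - Q₂ x * ψR x := by
    funext x
    rw [pressurePotential_eq_scale hR hv hL2 x]
    ring
  have iQ₁ : Integrable fun x => Q₁ x * ψR x :=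
    (hQ₁c.mul hψRcont).integrable_of_hasCompactSupport hψRc.mul_left
  have iQ₂ : Integrable fun x => Q₂ x * ψR x :=
    (hQ₂c.mul hψRcont).integrable_of_hasCompactSupport hψRc.mul_left
  -- the far part
  have hfar : |∫ x, Q₂ x * ψR x| ≤ m₂ * Pψ * E := by
    have hker : ∀ z, ‖fderiv ℝ (fderiv ℝ (newtonFar (R * 1) (R * 2))) z‖ ≤ R⁻¹ ^ 3 * m₂ :=
      norm_fderiv2_newtonFar_scale_le hR hm₂
    have hpt : ∀ x, |Q₂ x| ≤ R⁻¹ ^ 3 * m₂ * E := fun x => abs_farPotential_le hL2 hker x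
    calc |∫ x, Q₂ x * ψR x| ≤ ∫ x, R⁻¹ ^ 3 * m₂ * E * |ψR x| := by
          rw [← Real.norm_eq_abs]
          refine norm_integral_le_of_norm_le ((hψRcont.abs.integrable_of_hasCompactSupport
            hψRc.abs).const_mul _) (Eventually.of_forall fun x => ?_)
          rw [Real.norm_eq_abs, abs_mul]
          exact mul_le_mul_of_nonneg_right (hpt x) (abs_nonneg _)
      _ = m₂ * Pψ * E := by
          rw [integral_const_mul, hψR1]
          field_simp
  -- the near part: Fubini and two integrations by parts
  have hnear : |∫ x, Q₁ x * ψR x| ≤ N₁ * D₂ * E := by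
    -- a bound for `G` on the relevant compact set
    have hK : IsCompact (tsupport ψR ×ˢ closedBall (0 : ℝ³) (R * 2)) :=
      hψRc.isCompact.prod (isCompact_closedBall _ _)
    obtain ⟨CG, hCG⟩ := (hK.image (continuous_fst.sub continuous_snd)).exists_bound_of_continuousOn
      hGc.continuousOn
    have hCG' : ∀ x ∈ tsupport ψR, ∀ z ∈ closedBall (0 : ℝ³) (R * 2), ‖G (x - z)‖ ≤ CG :=
      fun x hx z hz => hCG (x - z) ⟨(x, z), ⟨hx, hz⟩, rfl⟩
    set CG' := max CG 0 with hCG'def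
    have hCGle : ∀ x ∈ tsupport ψR, ∀ z ∈ closedBall (0 : ℝ³) (R * 2), ‖G (x - z)‖ ≤ CG' :=
      fun x hx z hz => (hCG' x hx z hz).trans (le_max_left _ _)
    -- the Fubini integrand and its integrability on the product
    set F : ℝ³ → ℝ³ → ℝ := fun x z => ψR x * (newtonNear (R * 1) (R * 2) z * G (x - z)) with hF
    have hF_bound : ∀ x z, ‖F x z‖ ≤ (|ψR x| * CG') * |newtonNear (R * 1) (R * 2) z| := by
      intro x z
      simp only [hF, Real.norm_eq_abs, abs_mul]
      by_cases hx : x ∈ tsupport ψR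
      · by_cases hz : ‖z‖ ≤ R * 2
        · have := hCGle x hx z (mem_closedBall_zero_iff.2 hz)
          rw [Real.norm_eq_abs] at this
          calc |ψR x| * (|newtonNear (R * 1) (R * 2) z| * |G (x - z)|)
              ≤ |ψR x| * (|newtonNear (R * 1) (R * 2) z| * CG') := by gcongr
            _ = |ψR x| * CG' * |newtonNear (R * 1) (R * 2) z| := by ring
        · rw [newtonNear_eq_zero hR1.le hR2 (not_le.1 hz).le, abs_zero, zero_mul, mul_zero,
            mul_zero]
      · rw [image_eq_zero_of_notMem_tsupport hx, abs_zero, zero_mul, zero_mul, zero_mul]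
    have hF_meas : AEStronglyMeasurable (uncurry F) ((volume : Measure ℝ³).prod volume) := by
      refine Measurable.aestronglyMeasurable ?_
      exact (hψRcont.measurable.comp measurable_fst).mul
        (((measurable_newtonNear _ _).comp measurable_snd).mul
          (hGc.measurable.comp (measurable_fst.sub measurable_snd)))
    have hF_int : Integrable (uncurry F) ((volume : Measure ℝ³).prod volume) := by
      refine Integrable.mono' ?_ hF_meas (Eventually.of_forall fun q => hF_bound q.1 q.2)
      exact ((hψRcont.abs.integrable_of_hasCompactSupport hψRc.abs).mul_const CG').mul_prod
        (integrable_newtonNear hR1.le hR2).abs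
    -- Fubini
    have hswap : ∫ x, Q₁ x * ψR x =
        ∫ z, newtonNear (R * 1) (R * 2) z * ∫ x, ψR x * G (x - z) := by
      have e1 : (fun x => Q₁ x * ψR x) = fun x => ∫ z, F x z := by
        funext x
        rw [hQ₁, nearPotential, mul_comm, ← integral_const_mul]
      rw [e1, integral_integral_swap hF_int]
      refine integral_congr_ae (Eventually.of_forall fun z => ?_)
      show ∫ x, F x z = newtonNear (R * 1) (R * 2) z * ∫ x, ψR x * G (x - z)
      rw [← integral_const_mul]
      refine integral_congr_ae (Eventually.of_forall fun x => ?_)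
      simp only [hF]
      ring
    -- the inner integral after two integrations by parts
    have hJ : ∀ z, |∫ x, ψR x * G (x - z)| ≤ R⁻¹ ^ 2 * D₂ * E := by
      intro z
      have e1 : ∫ x, ψR x * G (x - z) = ∫ w, ψR (w + z) * G w := by
        rw [← integral_add_right_eq_self (fun x => ψR x * G (x - z)) z]
        simp only [add_sub_cancel_right]
      have hθ : ContDiff ℝ 2 fun w => ψR (w + z) := hψRs.comp (contDiff_id.add contDiff_const)
      have hθc : HasCompactSupport fun w => ψR (w + z) :=
        hψRc.comp_homeomorph (Homeomorph.addRight z)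
      have e2 : ∫ w, ψR (w + z) * G w = ∫ w, fderiv ℝ (fderiv ℝ ψR) (w + z) (v w) (v w) := by
        rw [hG, integral_mul_pressureSource hθ hθc hv]
        refine integral_congr_ae (Eventually.of_forall fun w => ?_)
        have h1 : fderiv ℝ (fun w => ψR (w + z)) = fun w => fderiv ℝ ψR (w + z) :=
          funext fun w => fderiv_comp_add_right z
        simp only [h1, fderiv_comp_add_right]
      rw [e1, e2, ← Real.norm_eq_abs]
      have hpt : ∀ w, ‖fderiv ℝ (fderiv ℝ ψR) (w + z) (v w) (v w)‖ ≤ R⁻¹ ^ 2 * D₂ * ‖v w‖ ^ 2 :=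
        fun w =>
        calc ‖fderiv ℝ (fderiv ℝ ψR) (w + z) (v w) (v w)‖
            ≤ ‖fderiv ℝ (fderiv ℝ ψR) (w + z) (v w)‖ * ‖v w‖ := ContinuousLinearMap.le_opNorm _ _
          _ ≤ ‖fderiv ℝ (fderiv ℝ ψR) (w + z)‖ * ‖v w‖ * ‖v w‖ := by
              gcongr; exact ContinuousLinearMap.le_opNorm _ _
          _ ≤ R⁻¹ ^ 2 * D₂ * ‖v w‖ * ‖v w‖ := by gcongr; exact hD2ψR _
          _ = R⁻¹ ^ 2 * D₂ * ‖v w‖ ^ 2 := by ring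
      have hle := norm_integral_le_of_norm_le (hL2.const_mul (R⁻¹ ^ 2 * D₂))
        (Eventually.of_forall hpt)
      rwa [integral_const_mul] at hle
    rw [hswap, ← Real.norm_eq_abs]
    calc ‖∫ z, newtonNear (R * 1) (R * 2) z * ∫ x, ψR x * G (x - z)‖
        ≤ ∫ z, |newtonNear (R * 1) (R * 2) z| * (R⁻¹ ^ 2 * D₂ * E) := by
          refine norm_integral_le_of_norm_le ((integrable_newtonNear hR1.le hR2).abs.mul_const _)
            (Eventually.of_forall fun z => ?_)
          rw [Real.norm_eq_abs, abs_mul]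
          exact mul_le_mul_of_nonneg_left (hJ z) (abs_nonneg _)
      _ = N₁ * D₂ * E := by
          rw [integral_mul_const, integral_abs_newtonNear_scale hR, hN₁]
          field_simp
  -- assembly
  have iQ₁n : Integrable fun x => -(Q₁ x * ψR x) := iQ₁.neg
  rw [hQ, integral_sub iQ₁n iQ₂, integral_neg]
  calc |-(∫ x, Q₁ x * ψR x) - ∫ x, Q₂ x * ψR x|
      ≤ |∫ x, Q₁ x * ψR x| + |∫ x, Q₂ x * ψR x| := by
        rw [show -(∫ x, Q₁ x * ψR x) - ∫ x, Q₂ x * ψR x =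
          -((∫ x, Q₁ x * ψR x) + ∫ x, Q₂ x * ψR x) by ring, abs_neg]
        exact abs_add_le _ _
    _ ≤ N₁ * D₂ * E + m₂ * Pψ * E := add_le_add hnear hfar
    _ = (m₂ * Pψ + N₁ * D₂) * E := by ring

end Duality

end Literature.Analysis.FluidPDE

end
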